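import Mathlib
import Literature.AlgebraicGeometry.HyperbolicPolynomials.SmoothConeShadow
import Literature.AlgebraicGeometry.HyperbolicPolynomials.MomentRelaxation
import Literature.AlgebraicGeometry.HyperbolicPolynomials.ArchimedeanCertificates
import Literature.RingTheory.MvPolynomial.IteratedDerivations
import HarnessLib

/-!
# Smooth hyperbolicity cones are spectrahedral shadows — the local step and the discharge

Topic `Literature/AlgebraicGeometry/HyperbolicPolynomials`. This file discharges the named fact
`NetzerSanyal2014_thm11` (`SpectrahedralShadow.lean`): **smooth hyperbolicity cones are
spectrahedral shadows** (Netzer–Sanyal, Math. Program. 153 (2015), Thm 1.1).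

`SmoothConeShadow.lean` proves the theorem conditionally on Helton–Nie's Theorem 2
(Math. Program. 122 (2010)); the only place where that input is used is the *local step*: for
every frontier point `a'` of the compact convex base `S' ⊆ ℝᵏ` some Euclidean ball around `a'`
meets `S'` in a spectrahedral shadow. Here we prove the local step directly
(`exists_isSpectrahedralShadow_inter_ball`), following Helton–Nie's own mechanism but on a ball
so small that no Positivstellensatz is needed:

1. (Helton–Nie 2010, Lemma 11, "modified Hessian") strict quasi-concavity of `g` at `a'` gives
   `M ≥ 0` with `p = g - M g²` having negative definite Hessian at `a'` (`exists_modifier`), hence,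
   by continuity, uniformly on a small ball; `{p ≥ 0} = {g ≥ 0}` near `a'`.
2. After the affine change of variables `w ↦ a' + εw` the piece becomes
   `N_w = {w | 1 - |w|² ≥ 0, p(a' + εw) ≥ 0}`; the Putinar-type moment relaxation of
   `MomentRelaxation.lean` is exact on `N_w` (`isSpectrahedralShadow_of_certificates`) because
   every supporting affine function `ℓ` has a certificate `ℓ = λ_p p_w + λ_q q + (sums of squares
   and q·squares of degree ≤ D)`: Lagrange multipliers at the minimiser (first-order conditions
   under the Mangasarian–Fromovitz condition, `exists_multipliers`), then Helton–Nie's Lemma 8 /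
   Lemma 19 form `ℓ - λ_p p_w - λ_q q = λ_p Φ + λ_q Σ vᵢ²` in coordinates `v = w - w*`, where
   `Φ = -(p̃ - p̃₀ - p̃₁)` has quadratic part `ε² (-½ ∇²p) ⪰ ε² λ₀` and higher coefficients
   `O(ε³)`, so that the perturbation lemma of `ArchimedeanCertificates.lean` applies for `ε`
   small — this replaces Helton–Nie's use of the degree-bounded matrix Positivstellensatz
   (their Theorems 27–29), the degree bound being uniform because the ball is small.
3. The assembly of Netzer–Sanyal's proof is then re-run verbatim from `SmoothConeShadow.lean`
   with the local step supplied by (2) (`NetzerSanyal2014_thm11_holds`).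

## References

* [NetzerSanyal2014] T. Netzer, R. Sanyal, Math. Program. 153 (2015) 213–221 (arXiv:1208.0441):
  Thm 1.1, Lemma 2.4, §3 (proof of Thm 3.1 and of Thm 1.1).
* [HeltonNie2008] J. W. Helton, J. Nie, Math. Program. 122 (2010) 21–64 (arXiv:0705.4068): §2.1
  (separating functionals, Lagrange multipliers), §2.2 (SDP representation II), Lemma 8
  (`f(x) = (x-u)ᵀ F (x-u)`), Lemma 11 (modified Hessian), Lemma 19, Theorem 2.
* [HeltonNie2009] J. W. Helton, J. Nie, SIAM J. Optim. 20 (2009) 759–791: Thm 3.3 and its proof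
  (localisation to balls `S ∩ B̄(u, δ)`).
* [Marshall2008] M. Marshall, *Positive polynomials and sums of squares* (2008), Cor. 5.2.4.
-/

noncomputable section

open MvPolynomial Filter Topology
open scoped BigOperators Matrix Polynomial

namespace Literature.AlgebraicGeometry.HyperbolicPolynomials

open Literature.RingTheory.MvPolynomial (shift shift_X eval_shift totalDegree_shift_le shift_shift
  shift_zero shift_pderiv shift_iterD_pderiv iterD dmap counts taylorFactor taylorFactor_pos
  coeff_iterD_pderiv exists_counts_eq totalDegree_aeval_le_of_le_one)

variable {k : ℕ}

/-! ### Polynomial toolkit: scaling, Taylor polynomials, low-order coefficients -/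

section Toolkit

/-- The scaling `Xᵢ ↦ ε Xᵢ`. [folklore] -/
def scalePoly (ε : ℝ) : MvPolynomial (Fin k) ℝ →ₐ[ℝ] MvPolynomial (Fin k) ℝ :=
  aeval fun i => C ε * X i

/-- [folklore] -/
theorem scalePoly_X (ε : ℝ) (i : Fin k) : scalePoly ε (X i) = C ε * X i := aeval_X _ i

/-- [folklore] -/
theorem scalePoly_C (ε r : ℝ) : scalePoly (k := k) ε (C r) = C r := by simp [scalePoly]

/-- Scaling a monomial multiplies its coefficient by `ε^{|α|}`. [folklore] -/
theorem scalePoly_monomial (ε : ℝ) (α : Fin k →₀ ℕ) (c : ℝ) :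
    scalePoly ε (monomial α c) = monomial α (ε ^ α.degree * c) := by
  rw [scalePoly, aeval_monomial, Finsupp.prod_pow, monomial_eq, Finsupp.prod_pow]
  simp only [mul_pow, Finset.prod_mul_distrib, ← map_pow, ← map_prod, algebraMap_eq]
  rw [Finset.prod_pow_eq_pow_sum, map_mul, show (∑ i, α i) = α.degree from ?_]
  · ring
  · rw [Finsupp.degree]
    exact (Finset.sum_subset (Finset.subset_univ _) fun i _ hi => Finsupp.notMem_support_iff.1 hi).symm

/-- [folklore] -/
theorem coeff_scalePoly (ε : ℝ) (f : MvPolynomial (Fin k) ℝ) (α : Fin k →₀ ℕ) :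
    coeff α (scalePoly ε f) = ε ^ α.degree * coeff α f := by
  classical
  conv_lhs => rw [f.as_sum, map_sum]
  simp only [scalePoly_monomial, coeff_sum, coeff_monomial]
  rw [Finset.sum_eq_single α (fun β _ hβ => if_neg hβ) (fun hα => by
    rw [if_pos rfl, notMem_support_iff.1 hα, mul_zero])]
  rw [if_pos rfl]

/-- [folklore] -/
theorem eval_scalePoly (ε : ℝ) (f : MvPolynomial (Fin k) ℝ) (x : Fin k → ℝ) :
    MvPolynomial.eval x (scalePoly ε f) = MvPolynomial.eval (ε • x) f := by
  induction f using MvPolynomial.induction_on with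
  | C a => simp [scalePoly]
  | add p q hp hq => rw [map_add, map_add, hp, hq, map_add]
  | mul_X p i hp => rw [map_mul, map_mul, hp, scalePoly_X, map_mul]; simp

/-- [folklore] -/
theorem totalDegree_scalePoly_le (ε : ℝ) (f : MvPolynomial (Fin k) ℝ) :
    (scalePoly ε f).totalDegree ≤ f.totalDegree :=
  totalDegree_aeval_le_of_le_one _ (fun i => (totalDegree_C_mul_le' _ _).trans (by
    rw [totalDegree_X])) f

/-- The **Taylor polynomial** of `p` at `x` in the scale `ε`: `v ↦ p(x + εv)`. [folklore] -/
def taylorAt (x : Fin k → ℝ) (ε : ℝ) (p : MvPolynomial (Fin k) ℝ) : MvPolynomial (Fin k) ℝ :=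
  scalePoly ε (shift x p)

/-- [folklore] -/
theorem eval_taylorAt (x : Fin k → ℝ) (ε : ℝ) (p : MvPolynomial (Fin k) ℝ) (v : Fin k → ℝ) :
    MvPolynomial.eval v (taylorAt x ε p) = MvPolynomial.eval (x + ε • v) p := by
  rw [taylorAt, eval_scalePoly, eval_shift, add_comm]

/-- [folklore] -/
theorem coeff_taylorAt (x : Fin k → ℝ) (ε : ℝ) (p : MvPolynomial (Fin k) ℝ) (α : Fin k →₀ ℕ) :
    coeff α (taylorAt x ε p) = ε ^ α.degree * coeff α (shift x p) := by
  rw [taylorAt, coeff_scalePoly]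

/-- [folklore] -/
theorem totalDegree_taylorAt_le (x : Fin k → ℝ) (ε : ℝ) (p : MvPolynomial (Fin k) ℝ) :
    (taylorAt x ε p).totalDegree ≤ p.totalDegree :=
  (totalDegree_scalePoly_le _ _).trans (totalDegree_shift_le _ _)

/-- Shifting a Taylor polynomial moves its centre: `p(x + ε(v + w)) = p((x + εw) + εv)`. [folklore] -/
theorem shift_taylorAt (x w : Fin k → ℝ) (ε : ℝ) (p : MvPolynomial (Fin k) ℝ) :
    shift w (taylorAt x ε p) = taylorAt (x + ε • w) ε p := by
  have h : (shift w).comp ((scalePoly ε).comp (shift x)) =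
      ((scalePoly ε).comp (shift (x + ε • w)) : MvPolynomial (Fin k) ℝ →ₐ[ℝ] MvPolynomial (Fin k) ℝ) := by
    refine algHom_ext fun i => ?_
    simp only [AlgHom.comp_apply, shift_X, map_add, scalePoly_X, scalePoly_C, map_mul, shift_C,
      Pi.add_apply, Pi.smul_apply, smul_eq_mul]
    ring
  exact congrArg (fun F : MvPolynomial (Fin k) ℝ →ₐ[ℝ] MvPolynomial (Fin k) ℝ => F p) h

/-- The constant coefficient of a shift is the value. [folklore] -/
theorem coeff_zero_shift (x : Fin k → ℝ) (p : MvPolynomial (Fin k) ℝ) :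
    coeff 0 (shift x p) = MvPolynomial.eval x p := by
  rw [← constantCoeff_eq, ← eval_zero, eval_shift, zero_add]

/-- The linear coefficients of a shift are the partial derivatives. [folklore] -/
theorem coeff_single_shift (x : Fin k → ℝ) (p : MvPolynomial (Fin k) ℝ) (i : Fin k) :
    coeff (Finsupp.single i 1) (shift x p) = MvPolynomial.eval x (pderiv i p) := by
  have h := coeff_pderiv (i := i) (shift x p) 0
  simp only [zero_add, Finsupp.coe_zero, Pi.zero_apply, Nat.cast_zero, mul_one] at h
  rw [← h, ← shift_pderiv, coeff_zero_shift]

/-- The line polynomial of a Taylor polynomial through the origin. [folklore] -/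
theorem linePoly_taylorAt (x : Fin k → ℝ) (ε : ℝ) (p : MvPolynomial (Fin k) ℝ) (v : Fin k → ℝ) :
    linePoly (taylorAt x ε p) 0 v = linePoly p x (ε • v) := by
  refine Polynomial.funext fun t => ?_
  rw [eval_linePoly, eval_linePoly, eval_taylorAt, zero_add, smul_smul, smul_smul, mul_comm]

/-- The line polynomial of a shift. [folklore] -/
theorem linePoly_shift (x y : Fin k → ℝ) (p : MvPolynomial (Fin k) ℝ) (v : Fin k → ℝ) :
    linePoly (shift x p) y v = linePoly p (y + x) v := by
  refine Polynomial.funext fun t => ?_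
  rw [eval_linePoly, eval_linePoly, eval_shift, add_right_comm]

/-- Scaling the direction scales `coeff 1` linearly. [folklore] -/
theorem coeff_one_linePoly_smul (p : MvPolynomial (Fin k) ℝ) (x v : Fin k → ℝ) (t : ℝ) :
    (linePoly p x (t • v)).coeff 1 = t * (linePoly p x v).coeff 1 := by
  rw [coeff_one_linePoly, coeff_one_linePoly, Finset.mul_sum]
  exact Finset.sum_congr rfl fun j _ => by simp only [Pi.smul_apply, smul_eq_mul]; ring

/-- Scaling the direction scales `coeff 2` quadratically. [folklore] -/
theorem coeff_two_linePoly_smul (p : MvPolynomial (Fin k) ℝ) (x v : Fin k → ℝ) (t : ℝ) :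
    (linePoly p x (t • v)).coeff 2 = t ^ 2 * (linePoly p x v).coeff 2 := by
  have h1 := two_mul_coeff_two_linePoly p x (t • v)
  have h2 := two_mul_coeff_two_linePoly p x v
  have : ∑ i, ∑ j, (t • v) i * (t • v) j * MvPolynomial.eval x (pderiv i (pderiv j p)) =
      t ^ 2 * ∑ i, ∑ j, v i * v j * MvPolynomial.eval x (pderiv i (pderiv j p)) := by
    rw [Finset.mul_sum]
    refine Finset.sum_congr rfl fun i _ => ?_
    rw [Finset.mul_sum]
    exact Finset.sum_congr rfl fun j _ => by simp only [Pi.smul_apply, smul_eq_mul]; ring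
  rw [this, ← h2] at h1
  linarith

/-- **Homogeneous components through the line polynomial**: the value of the degree-`m`
component of `f` at `v` is the coefficient of `t^m` in `t ↦ f(tv)`. [folklore] -/
theorem eval_homogeneousComponent_eq_coeff_linePoly (f : MvPolynomial (Fin k) ℝ) (m : ℕ)
    (v : Fin k → ℝ) :
    MvPolynomial.eval v (homogeneousComponent m f) = (linePoly f 0 v).coeff m := by
  classical
  have hdeg : ∀ α : Fin k →₀ ℕ, (∑ i, α i) = α.degree := fun α => by
    rw [Finsupp.degree]
    exact (Finset.sum_subset (Finset.subset_univ _) fun i _ hi =>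
      Finsupp.notMem_support_iff.1 hi).symm
  have key : ∀ (α : Fin k →₀ ℕ) (c : ℝ), MvPolynomial.eval v (homogeneousComponent m (monomial α c)) =
      (linePoly (monomial α c) 0 v).coeff m := by
    intro α c
    have hlp : linePoly (monomial α c) 0 v =
        Polynomial.C (c * ∏ i, v i ^ α i) * Polynomial.X ^ α.degree := by
      rw [linePoly, aeval_monomial, Finsupp.prod_pow, Polynomial.algebraMap_eq]
      simp only [Pi.zero_apply, map_zero, add_zero, mul_pow, Finset.prod_mul_distrib, ← map_pow,
        ← map_prod, Finset.prod_pow_eq_pow_sum]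
      rw [hdeg, map_mul, mul_assoc]
    have hmem : monomial α c ∈ homogeneousSubmodule (Fin k) ℝ α.degree := by
      rw [mem_homogeneousSubmodule]; exact isHomogeneous_monomial _ rfl
    rw [hlp, Polynomial.coeff_C_mul_X_pow, homogeneousComponent_of_mem hmem]
    split_ifs with h
    · rw [eval_monomial, Finsupp.prod_pow]
    · rw [map_zero]
  rw [f.as_sum, map_sum, map_sum, show linePoly (∑ α ∈ f.support, monomial α (coeff α f)) 0 v =
      ∑ α ∈ f.support, linePoly (monomial α (coeff α f)) 0 v by simp only [linePoly, map_sum],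
    Polynomial.finsetSum_coeff]
  exact Finset.sum_congr rfl fun α _ => key α _

/-- An exponent of degree one is a unit vector. [folklore] -/
theorem exists_eq_single_of_degree_eq_one {α : Fin k →₀ ℕ} (h : α.degree = 1) :
    ∃ i, α = Finsupp.single i 1 := by
  classical
  have hne : α ≠ 0 := fun h0 => by rw [h0, map_zero] at h; exact zero_ne_one h
  obtain ⟨i, hi⟩ : ∃ i, α i ≠ 0 := by
    by_contra hall
    push Not at hall
    exact hne (Finsupp.ext fun i => hall i)
  refine ⟨i, ?_⟩
  have hi_mem : i ∈ α.support := Finsupp.mem_support_iff.2 hi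
  have hsum : α.degree = ∑ j ∈ α.support, α j := rfl
  have hle : α i ≤ 1 := by
    rw [← h, hsum]; exact Finset.single_le_sum (fun j _ => Nat.zero_le _) hi_mem
  have hαi : α i = 1 := by omega
  have hrest : ∀ j, j ≠ i → α j = 0 := by
    intro j hji
    by_contra hj
    have hj_mem : j ∈ α.support := Finsupp.mem_support_iff.2 hj
    have h2 : α i + α j ≤ ∑ l ∈ α.support, α l := by
      rw [← Finset.sum_pair (Ne.symm hji)]
      exact Finset.sum_le_sum_of_subset (by
        intro l hl
        rcases Finset.mem_insert.1 hl with rfl | hl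
        · exact hi_mem
        · rw [Finset.mem_singleton.1 hl]; exact hj_mem)
    rw [← hsum, h, hαi] at h2
    omega
  ext j
  rcases eq_or_ne j i with rfl | hji
  · rw [hαi, Finsupp.single_eq_same]
  · rw [hrest j hji, Finsupp.single_eq_of_ne hji]

/-- The degree-one component vanishes when all linear coefficients do. [folklore] -/
theorem homogeneousComponent_one_eq_zero {f : MvPolynomial (Fin k) ℝ}
    (h : ∀ i, coeff (Finsupp.single i 1) f = 0) : homogeneousComponent 1 f = 0 := by
  ext α
  rw [coeff_homogeneousComponent, coeff_zero]
  split_ifs with hα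
  · obtain ⟨i, rfl⟩ := exists_eq_single_of_degree_eq_one hα
    exact h i
  · rfl

/-- The degree-zero component vanishes when the constant coefficient does. [folklore] -/
theorem homogeneousComponent_zero_eq_zero {f : MvPolynomial (Fin k) ℝ} (h : coeff 0 f = 0) :
    homogeneousComponent 0 f = 0 := by
  rw [homogeneousComponent_zero, h, map_zero]

/-- The part of `f` of degrees `3 … R`. [folklore] -/
def highPart (R : ℕ) (f : MvPolynomial (Fin k) ℝ) : MvPolynomial (Fin k) ℝ :=
  ∑ m ∈ Finset.Icc 3 R, homogeneousComponent m f

/-- [folklore] -/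
theorem coeff_highPart (R : ℕ) (f : MvPolynomial (Fin k) ℝ) (α : Fin k →₀ ℕ) :
    coeff α (highPart R f) = if 3 ≤ α.degree ∧ α.degree ≤ R then coeff α f else 0 := by
  rw [highPart, coeff_sum]
  simp only [coeff_homogeneousComponent]
  rw [Finset.sum_ite_eq (Finset.Icc 3 R) α.degree (fun _ => coeff α f)]
  simp only [Finset.mem_Icc]

/-- `highPart` is linear. [folklore] -/
theorem highPart_add (R : ℕ) (f g : MvPolynomial (Fin k) ℝ) :
    highPart R (f + g) = highPart R f + highPart R g := by
  simp only [highPart, map_add, Finset.sum_add_distrib]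

/-- [folklore] -/
theorem highPart_C_mul (R : ℕ) (c : ℝ) (f : MvPolynomial (Fin k) ℝ) :
    highPart R (C c * f) = C c * highPart R f := by
  simp only [highPart, homogeneousComponent_C_mul, Finset.mul_sum]

/-- [folklore] -/
theorem highPart_neg (R : ℕ) (f : MvPolynomial (Fin k) ℝ) : highPart R (-f) = -highPart R f := by
  simp only [highPart, map_neg, Finset.sum_neg_distrib]

/-- [folklore] -/
theorem highPart_sub (R : ℕ) (f g : MvPolynomial (Fin k) ℝ) :
    highPart R (f - g) = highPart R f - highPart R g := by
  rw [sub_eq_add_neg, highPart_add, highPart_neg, ← sub_eq_add_neg]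

/-- `highPart` kills polynomials of degree `≤ 2`. [folklore] -/
theorem highPart_eq_zero_of_totalDegree_le (R : ℕ) {f : MvPolynomial (Fin k) ℝ}
    (hf : f.totalDegree ≤ 2) : highPart R f = 0 := by
  refine Finset.sum_eq_zero fun m hm => homogeneousComponent_eq_zero _ _ ?_
  have := (Finset.mem_Icc.1 hm).1; omega

/-- The support of `highPart` lies in degrees `≥ 3`. [folklore] -/
theorem three_le_of_mem_support_highPart {R : ℕ} {f : MvPolynomial (Fin k) ℝ} {α : Fin k →₀ ℕ}
    (hα : α ∈ (highPart R f).support) : 3 ≤ α.degree := by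
  rw [mem_support_iff, coeff_highPart] at hα
  by_contra h
  exact hα (if_neg fun h' => h h'.1)

/-- `deg (highPart R f) ≤ R`. [folklore] -/
theorem totalDegree_highPart_le (R : ℕ) (f : MvPolynomial (Fin k) ℝ) :
    (highPart R f).totalDegree ≤ R :=
  totalDegree_finsetSum_le fun m hm =>
    ((homogeneousComponent_isHomogeneous m f).totalDegree_le).trans (Finset.mem_Icc.1 hm).2

/-- **Decomposition by degree**: `f = f₀ + f₁ + f₂ + (degrees 3 … R)` when `deg f ≤ R`. [folklore] -/
theorem eq_sum_homogeneousComponent_add_highPart {R : ℕ} (f : MvPolynomial (Fin k) ℝ)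
    (hf : f.totalDegree ≤ R) :
    f = homogeneousComponent 0 f + homogeneousComponent 1 f + homogeneousComponent 2 f +
      highPart R f := by
  ext α
  simp only [coeff_add, coeff_homogeneousComponent, coeff_highPart]
  by_cases hα : α ∈ f.support
  · have hdeg : α.degree ≤ R := (le_totalDegree hα).trans hf
    rcases Nat.lt_or_ge α.degree 3 with h3 | h3
    · interval_cases h : α.degree <;> simp_all
    · rw [if_neg (by omega), if_neg (by omega), if_neg (by omega), if_pos ⟨h3, hdeg⟩]; ring
  · rw [notMem_support_iff.1 hα]; simp

end Toolkit

/-! ### First-order optimality: Farkas for two functionals and Lagrange multipliers -/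

section KKT

variable {V : Type*} [AddCommGroup V] [Module ℝ V]

/-- A functional vanishing on the kernel of another is a multiple of it. [folklore] -/
theorem exists_eq_smul_of_forall_ker {φ ψ : V →ₗ[ℝ] ℝ} (h : ∀ d, ψ d = 0 → φ d = 0) :
    ∃ μ : ℝ, φ = μ • ψ := by
  by_cases hψ : ψ = 0
  · refine ⟨0, ?_⟩
    ext d
    rw [LinearMap.smul_apply, hψ, LinearMap.zero_apply, smul_zero]
    exact h d (by rw [hψ, LinearMap.zero_apply])
  · obtain ⟨u₀, hu₀⟩ : ∃ u₀, ψ u₀ ≠ 0 := by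
      by_contra hall; push Not at hall
      exact hψ (LinearMap.ext hall)
    set u₁ := (ψ u₀)⁻¹ • u₀ with hu₁
    have hψu₁ : ψ u₁ = 1 := by rw [hu₁, map_smul, smul_eq_mul, inv_mul_cancel₀ hu₀]
    refine ⟨φ u₁, ?_⟩
    ext d
    have hker : ψ (d - ψ d • u₁) = 0 := by rw [map_sub, map_smul, hψu₁, smul_eq_mul, mul_one, sub_self]
    have := h _ hker
    rw [map_sub, map_smul, smul_eq_mul, sub_eq_zero] at this
    rw [LinearMap.smul_apply, smul_eq_mul, this, mul_comm]

/-- **One-constraint Farkas lemma inside a subspace `{χ = 0}`**: if `φ ≥ 0` wherever `ψ ≥ 0`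
(both restricted to `ker χ`), then `φ = μ ψ` on `ker χ` for some `μ ≥ 0`. [folklore] -/
theorem exists_mul_of_forall_nonneg {φ ψ χ : V →ₗ[ℝ] ℝ}
    (h : ∀ d, χ d = 0 → 0 ≤ ψ d → 0 ≤ φ d) :
    ∃ μ : ℝ, 0 ≤ μ ∧ ∀ d, χ d = 0 → φ d = μ * ψ d := by
  have hzero : ∀ e, χ e = 0 → ψ e = 0 → φ e = 0 := by
    intro e he hψe
    have h1 := h e he hψe.ge
    have h2 := h (-e) (by rw [map_neg, he, neg_zero]) (by rw [map_neg, hψe, neg_zero])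
    rw [map_neg] at h2
    linarith
  by_cases hψ : ∀ u, χ u = 0 → ψ u = 0
  · exact ⟨0, le_rfl, fun d hd => by rw [hzero d hd (hψ d hd), zero_mul]⟩
  · push Not at hψ
    obtain ⟨u₀, hu₀χ, hu₀⟩ := hψ
    set u₁ := (ψ u₀)⁻¹ • u₀ with hu₁
    have hψu₁ : ψ u₁ = 1 := by rw [hu₁, map_smul, smul_eq_mul, inv_mul_cancel₀ hu₀]
    have hχu₁ : χ u₁ = 0 := by rw [hu₁, map_smul, hu₀χ, smul_zero]
    refine ⟨φ u₁, h u₁ hχu₁ (by rw [hψu₁]; exact zero_le_one), fun d hd => ?_⟩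
    have hker : ψ (d - ψ d • u₁) = 0 := by
      rw [map_sub, map_smul, hψu₁, smul_eq_mul, mul_one, sub_self]
    have hχ : χ (d - ψ d • u₁) = 0 := by rw [map_sub, map_smul, hd, hχu₁, smul_zero, sub_self]
    have := hzero _ hχ hker
    rw [map_sub, map_smul, smul_eq_mul, sub_eq_zero] at this
    rw [this, mul_comm]

/-- **Farkas lemma for two functionals** under a Mangasarian–Fromovitz type condition: if
`φ ≥ 0` on `{ψ₁ ≥ 0} ∩ {ψ₂ ≥ 0}` and there is `d₀` on which `ψ₂` is positive unless it vanishes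
(this half of the Mangasarian–Fromovitz condition is all that is needed for two functionals),
then `φ = μ₁ψ₁ + μ₂ψ₂` with `μ₁, μ₂ ≥ 0`. [folklore] -/
theorem exists_nonneg_combination {φ ψ₁ ψ₂ : V →ₗ[ℝ] ℝ}
    (h : ∀ d, 0 ≤ ψ₁ d → 0 ≤ ψ₂ d → 0 ≤ φ d) (d₀ : V)
    (h₂ : ψ₂ = 0 ∨ 0 < ψ₂ d₀) :
    ∃ μ₁ μ₂ : ℝ, 0 ≤ μ₁ ∧ 0 ≤ μ₂ ∧ φ = μ₁ • ψ₁ + μ₂ • ψ₂ := by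
  -- representation with `μ₂ ≥ 0`
  have rep : ∀ {ψ₁ ψ₂ : V →ₗ[ℝ] ℝ}, (∀ d, 0 ≤ ψ₁ d → 0 ≤ ψ₂ d → 0 ≤ φ d) →
      ∃ μ₁ μ₂ : ℝ, 0 ≤ μ₂ ∧ φ = μ₁ • ψ₁ + μ₂ • ψ₂ := by
    intro ψ₁ ψ₂ h
    obtain ⟨μ₂, hμ₂, hk⟩ := exists_mul_of_forall_nonneg (φ := φ) (ψ := ψ₂) (χ := ψ₁)
      (fun d hd hψ => h d hd.ge hψ)
    obtain ⟨μ₁, hμ₁⟩ := exists_eq_smul_of_forall_ker (φ := φ - μ₂ • ψ₂) (ψ := ψ₁) (fun d hd => by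
      rw [LinearMap.sub_apply, LinearMap.smul_apply, smul_eq_mul, hk d hd, sub_self])
    exact ⟨μ₁, μ₂, hμ₂, by rw [← hμ₁]; abel⟩
  obtain ⟨μ₁, μ₂, hμ₂, e1⟩ := rep h
  obtain ⟨ν₂, ν₁, hν₁, e2⟩ := rep (ψ₁ := ψ₂) (ψ₂ := ψ₁) fun d hd2 hd1 => h d hd1 hd2
  -- `φ = μ₁ψ₁ + μ₂ψ₂ = ν₁ψ₁ + ν₂ψ₂` with `μ₂, ν₁ ≥ 0`
  by_cases hμ₁ : 0 ≤ μ₁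
  · exact ⟨μ₁, μ₂, hμ₁, hμ₂, e1⟩
  by_cases hν₂ : 0 ≤ ν₂
  · exact ⟨ν₁, ν₂, hν₁, hν₂, by rw [e2]; abel⟩
  push Not at hμ₁ hν₂
  -- then `(μ₁ - ν₁) ψ₁ = (ν₂ - μ₂) ψ₂` with negative coefficients: `ψ₁ = t ψ₂`, `t > 0`
  have hrel : (μ₁ - ν₁) • ψ₁ = (ν₂ - μ₂) • ψ₂ := by
    have := e1.symm.trans (e2.trans (add_comm _ _))
    rw [← sub_eq_zero] at this ⊢
    rw [← this]; module
  have hc1 : μ₁ - ν₁ < 0 := by linarith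
  have hc2 : ν₂ - μ₂ < 0 := by linarith
  set t : ℝ := (ν₂ - μ₂) / (μ₁ - ν₁) with ht
  have htpos : 0 < t := div_pos_of_neg_of_neg hc2 hc1
  have hψ₁ : ψ₁ = t • ψ₂ := by
    have := congrArg (fun F : V →ₗ[ℝ] ℝ => (μ₁ - ν₁)⁻¹ • F) hrel
    simp only [smul_smul, inv_mul_cancel₀ hc1.ne, one_smul] at this
    rw [this, ht, div_eq_inv_mul]
  rcases h₂ with hψ₂ | hψ₂
  · refine ⟨0, 0, le_rfl, le_rfl, ?_⟩
    rw [e1, hψ₁, hψ₂]; simp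
  · have hφ : φ = (ν₂ + ν₁ * t) • ψ₂ := by rw [e2, hψ₁, smul_smul, ← add_smul]
    have hcoef : 0 ≤ ν₂ + ν₁ * t := by
      have h0 : 0 ≤ φ d₀ := h d₀ (by rw [hψ₁, LinearMap.smul_apply, smul_eq_mul]; positivity) hψ₂.le
      rw [hφ, LinearMap.smul_apply, smul_eq_mul] at h0
      exact nonneg_of_mul_nonneg_left h0 hψ₂
    exact ⟨0, ν₂ + ν₁ * t, le_rfl, hcoef, by rw [hφ, zero_smul, zero_add]⟩

/-- From strict to weak: if `φ ≥ 0` on the open cone `{ψᵢ > 0 for the non-zero ψᵢ}` and that cone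
is non-empty (`d₀`), then `φ ≥ 0` on the closed cone. [folklore] -/
theorem nonneg_of_forall_pos {φ ψ₁ ψ₂ : V →ₗ[ℝ] ℝ}
    (h : ∀ d, (ψ₁ = 0 ∨ 0 < ψ₁ d) → (ψ₂ = 0 ∨ 0 < ψ₂ d) → 0 ≤ φ d) (d₀ : V)
    (h₁ : ψ₁ = 0 ∨ 0 < ψ₁ d₀) (h₂ : ψ₂ = 0 ∨ 0 < ψ₂ d₀) :
    ∀ d, 0 ≤ ψ₁ d → 0 ≤ ψ₂ d → 0 ≤ φ d := by
  intro d hd1 hd2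
  have hs : ∀ s : ℝ, 0 < s → 0 ≤ φ d + s * φ d₀ := by
    intro s hs
    have := h (d + s • d₀)
      (h₁.imp id fun hp => by rw [map_add, map_smul, smul_eq_mul]; nlinarith)
      (h₂.imp id fun hp => by rw [map_add, map_smul, smul_eq_mul]; nlinarith)
    rwa [map_add, map_smul, smul_eq_mul] at this
  by_contra hneg
  push Not at hneg
  by_cases h0 : φ d₀ ≤ 0
  · have := hs 1 one_pos; linarith
  · push Not at h0
    obtain ⟨s, hs_def⟩ : ∃ s : ℝ, s = -(φ d) / (2 * φ d₀) := ⟨_, rfl⟩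
    have hspos : 0 < s := by rw [hs_def]; exact div_pos (by linarith) (by linarith)
    have hsval : s * φ d₀ = -(φ d) / 2 := by rw [hs_def]; field_simp
    have := hs s hspos
    rw [hsval] at this
    linarith

end KKT

/-! ### Lagrange multipliers for two polynomial constraints -/

section Multipliers

/-- `gradForm f x eⱼ = ∂ⱼ f(x)`. [folklore] -/
theorem gradForm_single (f : MvPolynomial (Fin k) ℝ) (x : Fin k → ℝ) (j : Fin k) :
    gradForm f x (Pi.single j 1) = MvPolynomial.eval x (pderiv j f) := by
  classical
  rw [gradForm_apply, coeff_one_linePoly_single]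

/-- **First-order conditions with Lagrange multipliers** for minimising a linear functional over
`{h₁ ≥ 0} ∩ {h₂ ≥ 0}` at a point where the Mangasarian–Fromovitz condition holds (a direction
`d₀` strictly increasing every active constraint): `c = λ₁ ∇h₁(w) + λ₂ ∇h₂(w)` with `λᵢ ≥ 0` and
complementary slackness (Helton–Nie: "the first order optimality condition is satisfied. So
there exist Lagrange multipliers `λᵢ ≥ 0` such that `ℓ = Σ λᵢ ∇gᵢ(u)`").
[cite: HeltonNie2008, §2.1 (Lagrange multipliers at the minimiser)] -/
theorem exists_multipliers {h₁ h₂ : MvPolynomial (Fin k) ℝ} {w : Fin k → ℝ}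
    (hw₁ : 0 ≤ MvPolynomial.eval w h₁) (hw₂ : 0 ≤ MvPolynomial.eval w h₂)
    (c : (Fin k → ℝ) →ₗ[ℝ] ℝ)
    (hmin : ∀ z, 0 ≤ MvPolynomial.eval z h₁ → 0 ≤ MvPolynomial.eval z h₂ → c w ≤ c z)
    (d₀ : Fin k → ℝ) (hd₁ : MvPolynomial.eval w h₁ = 0 → 0 < gradForm h₁ w d₀)
    (hd₂ : MvPolynomial.eval w h₂ = 0 → 0 < gradForm h₂ w d₀) :
    ∃ l₁ l₂ : ℝ, 0 ≤ l₁ ∧ 0 ≤ l₂ ∧ l₁ * MvPolynomial.eval w h₁ = 0 ∧ l₂ * MvPolynomial.eval w h₂ = 0 ∧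
      ∀ j, c (Pi.single j 1) =
        l₁ * MvPolynomial.eval w (pderiv j h₁) + l₂ * MvPolynomial.eval w (pderiv j h₂) := by
  classical
  -- the functionals of the active constraints
  let ψ₁ : (Fin k → ℝ) →ₗ[ℝ] ℝ := if MvPolynomial.eval w h₁ = 0 then gradForm h₁ w else 0
  let ψ₂ : (Fin k → ℝ) →ₗ[ℝ] ℝ := if MvPolynomial.eval w h₂ = 0 then gradForm h₂ w else 0
  -- feasibility along directions increasing the active constraints
  have hfeas : ∀ (h : MvPolynomial (Fin k) ℝ) (ψ : (Fin k → ℝ) →ₗ[ℝ] ℝ),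
      0 ≤ MvPolynomial.eval w h → ψ = (if MvPolynomial.eval w h = 0 then gradForm h w else 0) →
      (MvPolynomial.eval w h = 0 → gradForm h w ≠ 0) →
      ∀ d, (ψ = 0 ∨ 0 < ψ d) → ∀ᶠ t in 𝓝[>] (0 : ℝ), 0 ≤ MvPolynomial.eval (w + t • d) h := by
    intro h ψ hwh hψ hgrad d hd
    by_cases ha : MvPolynomial.eval w h = 0
    · have hψ' : ψ = gradForm h w := by rw [hψ, if_pos ha]
      have hpos : 0 < gradForm h w d := by
        rcases hd with hd | hd
        · exact absurd (hψ'.symm.trans hd) (hgrad ha)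
        · rwa [hψ'] at hd
      rw [gradForm_apply] at hpos
      have h0 : (linePoly h w d).eval 0 = 0 := by rw [eval_linePoly, zero_smul, add_zero, ha]
      filter_upwards [(linePoly h w d).eventually_mul_le_eval h0 hpos, self_mem_nhdsWithin]
        with t ht ht0
      rw [eval_linePoly] at ht
      have : 0 ≤ (linePoly h w d).coeff 1 / 2 * t := by
        have := Set.mem_Ioi.1 ht0; positivity
      linarith
    · have hpos : 0 < MvPolynomial.eval w h := lt_of_le_of_ne hwh (Ne.symm ha)
      have hcont : Continuous fun t : ℝ => MvPolynomial.eval (w + t • d) h :=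
        (continuous_eval h).comp (continuous_const.add (continuous_id.smul continuous_const))
      have hev : ∀ᶠ t in 𝓝 (0 : ℝ), 0 < MvPolynomial.eval (w + t • d) h := by
        have := hcont.continuousAt (x := 0) |>.eventually (lt_mem_nhds (by simpa using hpos))
        exact this
      exact (hev.filter_mono nhdsWithin_le_nhds).mono fun t ht => ht.le
  have hg₁ : MvPolynomial.eval w h₁ = 0 → gradForm h₁ w ≠ 0 := fun ha h0 => by
    have := hd₁ ha; rw [h0, LinearMap.zero_apply] at this; exact lt_irrefl _ this
  have hg₂ : MvPolynomial.eval w h₂ = 0 → gradForm h₂ w ≠ 0 := fun ha h0 => by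
    have := hd₂ ha; rw [h0, LinearMap.zero_apply] at this; exact lt_irrefl _ this
  -- tangent step
  have htan : ∀ d, (ψ₁ = 0 ∨ 0 < ψ₁ d) → (ψ₂ = 0 ∨ 0 < ψ₂ d) → 0 ≤ c d := by
    intro d H1 H2
    have e1 := hfeas h₁ ψ₁ hw₁ rfl hg₁ d H1
    have e2 := hfeas h₂ ψ₂ hw₂ rfl hg₂ d H2
    obtain ⟨t, ⟨ht1, ht2⟩, ht0⟩ := ((e1.and e2).and self_mem_nhdsWithin).exists
    have hle := hmin (w + t • d) ht1 ht2
    rw [map_add, map_smul, smul_eq_mul] at hle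
    have : 0 ≤ t * c d := by linarith
    exact nonneg_of_mul_nonneg_right this (Set.mem_Ioi.1 ht0) |> fun h => by
      rcases (mul_nonneg_iff_of_pos_left (Set.mem_Ioi.1 ht0)).1 this with h'
      exact h'
  -- MFCQ at `d₀`
  have hm₁ : ψ₁ = 0 ∨ 0 < ψ₁ d₀ := by
    by_cases ha : MvPolynomial.eval w h₁ = 0
    · right; simp only [ψ₁, if_pos ha]; exact hd₁ ha
    · left; simp only [ψ₁, if_neg ha]
  have hm₂ : ψ₂ = 0 ∨ 0 < ψ₂ d₀ := by
    by_cases ha : MvPolynomial.eval w h₂ = 0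
    · right; simp only [ψ₂, if_pos ha]; exact hd₂ ha
    · left; simp only [ψ₂, if_neg ha]
  have hclosed := nonneg_of_forall_pos htan d₀ hm₁ hm₂
  obtain ⟨μ₁, μ₂, hμ₁, hμ₂, hc⟩ := exists_nonneg_combination hclosed d₀ hm₂
  refine ⟨if MvPolynomial.eval w h₁ = 0 then μ₁ else 0, if MvPolynomial.eval w h₂ = 0 then μ₂ else 0,
    by split_ifs <;> simp [hμ₁], by split_ifs <;> simp [hμ₂], by split_ifs with h <;> simp [h],
    by split_ifs with h <;> simp [h], fun j => ?_⟩
  have := congrArg (fun F : (Fin k → ℝ) →ₗ[ℝ] ℝ => F (Pi.single j 1)) hc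
  simp only [LinearMap.add_apply, LinearMap.smul_apply, smul_eq_mul] at this
  rw [this]
  simp only [ψ₁, ψ₂]
  split_ifs <;> simp [gradForm_single]

end Multipliers

/-! ### The modified Hessian (Helton–Nie 2010, Lemma 11) and uniform constants -/

section Modifier

/-- [folklore] -/
theorem continuous_coeff_one_linePoly (g : MvPolynomial (Fin k) ℝ) (x : Fin k → ℝ) :
    Continuous fun v : Fin k → ℝ => (linePoly g x v).coeff 1 := by
  simp only [coeff_one_linePoly]
  exact continuous_finsetSum _ fun j _ => (continuous_apply j).mul continuous_const

/-- [folklore] -/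
theorem coeff_two_linePoly_eq_half_sum (g : MvPolynomial (Fin k) ℝ) (x v : Fin k → ℝ) :
    (linePoly g x v).coeff 2 =
      (1 / 2 : ℝ) * ∑ i, ∑ j, v i * v j * MvPolynomial.eval x (pderiv i (pderiv j g)) := by
  have := two_mul_coeff_two_linePoly g x v
  linarith

/-- [folklore] -/
theorem continuous_coeff_two_linePoly (g : MvPolynomial (Fin k) ℝ) (x : Fin k → ℝ) :
    Continuous fun v : Fin k → ℝ => (linePoly g x v).coeff 2 := by
  simp only [coeff_two_linePoly_eq_half_sum]
  exact continuous_const.mul (continuous_finsetSum _ fun i _ => continuous_finsetSum _ fun j _ =>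
    ((continuous_apply i).mul (continuous_apply j)).mul continuous_const)

/-- [folklore] -/
theorem coeff_linePoly_zero_dir (g : MvPolynomial (Fin k) ℝ) (x : Fin k → ℝ) {m : ℕ} (hm : m ≠ 0) :
    (linePoly g x 0).coeff m = 0 := by
  rw [linePoly_zero_dir, Polynomial.coeff_C, if_neg hm]

/-- **Helton–Nie's modified Hessian** (Math. Program. 122 (2010), Lemma 11 (a)): if `g` is strictly
quasi-concave at `a` then for some `M ≥ 0` the quadratic form `M (∇g(a)·v)² - ½ vᵀ∇²g(a)v`
(which is `-½ vᵀ∇²p(a) v` for `p = g - M g²` when `g(a) = 0`) is positive definite. Proof by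
compactness of the unit sphere (Finsler's lemma). [cite: HeltonNie2008, Lemma 11] -/
theorem exists_modifier {g : MvPolynomial (Fin k) ℝ} {a : Fin k → ℝ} (hsqc : IsStrictlyQuasiConcaveAt g a) :
    ∃ M : ℝ, 0 ≤ M ∧ ∃ lam : ℝ, 0 < lam ∧ ∀ v : Fin k → ℝ,
      lam * ∑ i, v i ^ 2 ≤ M * ((linePoly g a v).coeff 1) ^ 2 - (linePoly g a v).coeff 2 := by
  have hc1c : Continuous fun v : Fin k → ℝ => (linePoly g a v).coeff 1 := continuous_coeff_one_linePoly g a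
  have hc2c : Continuous fun v : Fin k → ℝ => (linePoly g a v).coeff 2 := continuous_coeff_two_linePoly g a
  have hScpt : IsCompact (Metric.sphere (0 : Fin k → ℝ) 1) := isCompact_sphere 0 1
  have hS0 : ∀ v ∈ Metric.sphere (0 : Fin k → ℝ) 1, v ≠ 0 := by
    intro v hv h0
    rw [h0] at hv
    simp at hv
  -- bound for the quadratic coefficient on the sphere
  obtain ⟨Cmax, hCmax⟩ : ∃ Cmax : ℝ, ∀ v ∈ Metric.sphere (0 : Fin k → ℝ) 1, (linePoly g a v).coeff 2 ≤ Cmax := by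
    obtain ⟨B, hB⟩ := hScpt.exists_bound_of_continuousOn hc2c.continuousOn
    exact ⟨B, fun v hv => (le_abs_self _).trans ((Real.norm_eq_abs _).symm.le.trans (hB v hv))⟩
  -- positive lower bound for `(coeff 1)²` where `coeff 2 ≥ 0`
  obtain ⟨β, hβpos, hβ⟩ : ∃ β : ℝ, 0 < β ∧ ∀ v ∈ Metric.sphere (0 : Fin k → ℝ) 1,
      0 ≤ (linePoly g a v).coeff 2 → β ≤ ((linePoly g a v).coeff 1) ^ 2 := by
    have hcpt0 : IsCompact (Metric.sphere (0 : Fin k → ℝ) 1 ∩ {v | 0 ≤ (linePoly g a v).coeff 2}) :=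
      hScpt.inter_right (isClosed_le continuous_const hc2c)
    rcases (Metric.sphere (0 : Fin k → ℝ) 1 ∩ {v | 0 ≤ (linePoly g a v).coeff 2}).eq_empty_or_nonempty
      with h0 | hne
    · refine ⟨1, one_pos, fun v hv h2 => ?_⟩
      have : v ∈ Metric.sphere (0 : Fin k → ℝ) 1 ∩ {v | 0 ≤ (linePoly g a v).coeff 2} := ⟨hv, h2⟩
      rw [h0] at this
      exact absurd this (Set.notMem_empty v)
    · obtain ⟨v₀, hv₀, hmin⟩ := hcpt0.exists_isMinOn hne (hc1c.pow 2).continuousOn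
      have hne1 : (linePoly g a v₀).coeff 1 ≠ 0 := fun h1 =>
        absurd hv₀.2 (not_le.2 (hsqc v₀ (hS0 v₀ hv₀.1) h1))
      exact ⟨((linePoly g a v₀).coeff 1) ^ 2, by positivity, fun v hv h2 => hmin ⟨hv, h2⟩⟩
  -- the modifier
  obtain ⟨M, hM⟩ : ∃ M : ℝ, M = (|Cmax| + 1) / β := ⟨_, rfl⟩
  have hMnn : 0 ≤ M := by rw [hM]; positivity
  have hF : ∀ v ∈ Metric.sphere (0 : Fin k → ℝ) 1,
      0 < M * ((linePoly g a v).coeff 1) ^ 2 - (linePoly g a v).coeff 2 := by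
    intro v hv
    by_cases h2 : 0 ≤ (linePoly g a v).coeff 2
    · have hb := hβ v hv h2
      have hge : |Cmax| + 1 ≤ M * ((linePoly g a v).coeff 1) ^ 2 := by
        rw [hM]
        calc |Cmax| + 1 = (|Cmax| + 1) / β * β := (div_mul_cancel₀ _ hβpos.ne').symm
          _ ≤ (|Cmax| + 1) / β * ((linePoly g a v).coeff 1) ^ 2 :=
            mul_le_mul_of_nonneg_left hb (by positivity)
      have hc := hCmax v hv
      have := le_abs_self Cmax
      linarith
    · push Not at h2
      have : 0 ≤ M * ((linePoly g a v).coeff 1) ^ 2 := by positivity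
      linarith
  have hFc : Continuous fun v : Fin k → ℝ => M * ((linePoly g a v).coeff 1) ^ 2 - (linePoly g a v).coeff 2 :=
    (continuous_const.mul (hc1c.pow 2)).sub hc2c
  have hzero : M * ((linePoly g a 0).coeff 1) ^ 2 - (linePoly g a 0).coeff 2 = 0 := by
    rw [coeff_linePoly_zero_dir g a one_ne_zero, coeff_linePoly_zero_dir g a two_ne_zero]; ring
  rcases Nat.eq_zero_or_pos k with hk | hk
  · subst hk
    refine ⟨M, hMnn, 1, one_pos, fun v => ?_⟩
    have hv : v = 0 := funext fun i => Fin.elim0 i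
    rw [hv, hzero]; simp
  · haveI : Nonempty (Fin k) := ⟨⟨0, hk⟩⟩
    have hSne : (Metric.sphere (0 : Fin k → ℝ) 1).Nonempty := NormedSpace.sphere_nonempty.2 zero_le_one
    obtain ⟨v₁, hv₁, hmin⟩ := hScpt.exists_isMinOn hSne hFc.continuousOn
    have hlam1 : 0 < M * ((linePoly g a v₁).coeff 1) ^ 2 - (linePoly g a v₁).coeff 2 := hF v₁ hv₁
    refine ⟨M, hMnn, (M * ((linePoly g a v₁).coeff 1) ^ 2 - (linePoly g a v₁).coeff 2) / (k + 1),
      div_pos hlam1 (by positivity), fun v => ?_⟩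
    rcases eq_or_ne v 0 with rfl | hv0
    · rw [hzero]; simp
    · obtain ⟨r, hr⟩ : ∃ r : ℝ, r = ‖v‖ := ⟨_, rfl⟩
      have hrpos : 0 < r := by rw [hr]; exact norm_pos_iff.2 hv0
      obtain ⟨u, hu⟩ : ∃ u : Fin k → ℝ, u = r⁻¹ • v := ⟨_, rfl⟩
      have huS : u ∈ Metric.sphere (0 : Fin k → ℝ) 1 := by
        rw [mem_sphere_zero_iff_norm, hu, norm_smul, norm_inv, Real.norm_eq_abs, abs_of_pos hrpos,
          ← hr, inv_mul_cancel₀ hrpos.ne']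
      have hvu : v = r • u := by rw [hu, smul_smul, mul_inv_cancel₀ hrpos.ne', one_smul]
      have hFu := hmin huS
      rw [isMinOn_iff] at hmin
      have hFu' : M * ((linePoly g a v₁).coeff 1) ^ 2 - (linePoly g a v₁).coeff 2 ≤
          M * ((linePoly g a u).coeff 1) ^ 2 - (linePoly g a u).coeff 2 := hmin u huS
      have e1 : (linePoly g a v).coeff 1 = r * (linePoly g a u).coeff 1 := by
        rw [hvu]; exact coeff_one_linePoly_smul g a u r
      have e2 : (linePoly g a v).coeff 2 = r ^ 2 * (linePoly g a u).coeff 2 := by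
        rw [hvu]; exact coeff_two_linePoly_smul g a u r
      have hsum : ∑ i, v i ^ 2 ≤ k * r ^ 2 := by rw [hr]; exact sumSq_le_card_mul_norm_sq v
      have hk1 : (k : ℝ) / (k + 1) ≤ 1 := by rw [div_le_one (by positivity)]; linarith
      set Λ := M * ((linePoly g a v₁).coeff 1) ^ 2 - (linePoly g a v₁).coeff 2 with hΛ
      calc Λ / (k + 1) * ∑ i, v i ^ 2 ≤ Λ / (k + 1) * (k * r ^ 2) :=
            mul_le_mul_of_nonneg_left hsum (div_pos hlam1 (by positivity)).le
        _ = Λ * r ^ 2 * ((k : ℝ) / (k + 1)) := by ring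
        _ ≤ Λ * r ^ 2 * 1 := mul_le_mul_of_nonneg_left hk1 (by positivity)
        _ ≤ (M * ((linePoly g a u).coeff 1) ^ 2 - (linePoly g a u).coeff 2) * r ^ 2 := by
            rw [mul_one]; exact mul_le_mul_of_nonneg_right hFu' (sq_nonneg r)
        _ = M * ((linePoly g a v).coeff 1) ^ 2 - (linePoly g a v).coeff 2 := by rw [e1, e2]; ring

/-- `Σᵢⱼ |vᵢ||vⱼ| ≤ k Σ vᵢ²`. [folklore] -/
theorem sum_abs_mul_abs_le (v : Fin k → ℝ) : ∑ i, ∑ j, |v i| * |v j| ≤ k * ∑ i, v i ^ 2 := by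
  calc ∑ i, ∑ j, |v i| * |v j| ≤ ∑ i, ∑ j, (v i ^ 2 + v j ^ 2) / 2 :=
        Finset.sum_le_sum fun i _ => Finset.sum_le_sum fun j _ => by
          nlinarith [sq_nonneg (|v i| - |v j|), sq_abs (v i), sq_abs (v j)]
    _ = k * ∑ i, v i ^ 2 := by
        have h1 : ∀ i : Fin k, ∑ j, (v i ^ 2 + v j ^ 2) / 2 = (k * v i ^ 2 + ∑ j, v j ^ 2) / 2 := by
          intro i
          rw [← Finset.sum_div, Finset.sum_add_distrib, Finset.sum_const, Finset.card_univ,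
            Fintype.card_fin, nsmul_eq_mul]
        simp only [h1]
        rw [← Finset.sum_div, Finset.sum_add_distrib, Finset.sum_const, Finset.card_univ,
          Fintype.card_fin, nsmul_eq_mul, ← Finset.mul_sum]
        ring

/-- **Uniform negative definiteness near `a`**: if `-coeff₂ ≥ 2λ|v|²` at `a` then `-coeff₂ ≥ λ|v|²`
on a sup-norm ball around `a` (continuity of the second derivatives). [folklore] -/
theorem exists_ball_coeff_two_le {p : MvPolynomial (Fin k) ℝ} {a : Fin k → ℝ} {lam : ℝ}
    (hlam : 0 < lam) (h : ∀ v : Fin k → ℝ, 2 * lam * ∑ i, v i ^ 2 ≤ -(linePoly p a v).coeff 2) :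
    ∃ ρ : ℝ, 0 < ρ ∧ ∀ x : Fin k → ℝ, dist x a ≤ ρ →
      ∀ v : Fin k → ℝ, lam * ∑ i, v i ^ 2 ≤ -(linePoly p x v).coeff 2 := by
  let H : (Fin k → ℝ) → (Fin k → Fin k → ℝ) := fun x i j => MvPolynomial.eval x (pderiv i (pderiv j p))
  have hHc : Continuous H :=
    continuous_pi fun i => continuous_pi fun j => continuous_eval (pderiv i (pderiv j p))
  have hη : 0 < 2 * lam / (k + 1) := by positivity
  obtain ⟨ρ, hρ, hball⟩ := Metric.continuousAt_iff.1 hHc.continuousAt _ hη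
  refine ⟨ρ / 2, half_pos hρ, fun x hx v => ?_⟩
  have hd : dist (H x) (H a) < 2 * lam / (k + 1) := hball (lt_of_le_of_lt hx (half_lt_self hρ))
  have hentry : ∀ i j, |H x i j - H a i j| ≤ 2 * lam / (k + 1) := fun i j => by
    rw [← Real.dist_eq]
    exact ((dist_le_pi_dist (H x i) (H a i) j).trans (dist_le_pi_dist (H x) (H a) i)).trans hd.le
  have ex := two_mul_coeff_two_linePoly p x v
  have ea := two_mul_coeff_two_linePoly p a v
  have hdiff : |∑ i, ∑ j, v i * v j * H x i j - ∑ i, ∑ j, v i * v j * H a i j| ≤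
      2 * lam / (k + 1) * (k * ∑ i, v i ^ 2) := by
    rw [← Finset.sum_sub_distrib]
    refine (Finset.abs_sum_le_sum_abs _ _).trans ?_
    calc ∑ i, |∑ j, v i * v j * H x i j - ∑ j, v i * v j * H a i j|
        ≤ ∑ i, ∑ j, |v i| * |v j| * (2 * lam / (k + 1)) := Finset.sum_le_sum fun i _ => by
          rw [← Finset.sum_sub_distrib]
          refine (Finset.abs_sum_le_sum_abs _ _).trans (Finset.sum_le_sum fun j _ => ?_)
          rw [← mul_sub, abs_mul, abs_mul]
          exact mul_le_mul_of_nonneg_left (hentry i j) (by positivity)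
      _ = 2 * lam / (k + 1) * ∑ i, ∑ j, |v i| * |v j| := by
          rw [Finset.mul_sum]; refine Finset.sum_congr rfl fun i _ => ?_
          rw [Finset.mul_sum]; exact Finset.sum_congr rfl fun j _ => by ring
      _ ≤ 2 * lam / (k + 1) * (k * ∑ i, v i ^ 2) :=
          mul_le_mul_of_nonneg_left (sum_abs_mul_abs_le v) hη.le
  have hk1 : 2 * lam / (k + 1) * (k * ∑ i, v i ^ 2) ≤ 2 * lam * ∑ i, v i ^ 2 := by
    have hs : 0 ≤ ∑ i, v i ^ 2 := Finset.sum_nonneg fun i _ => sq_nonneg _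
    rw [div_mul_eq_mul_div, div_le_iff₀ (by positivity : (0 : ℝ) < k + 1)]
    nlinarith
  have ha := h v
  have habs := (abs_sub_le_iff.1 hdiff).1
  change 2 * (linePoly p x v).coeff 2 = ∑ i, ∑ j, v i * v j * H x i j at ex
  change 2 * (linePoly p a v).coeff 2 = ∑ i, ∑ j, v i * v j * H a i j at ea
  linarith

/-- **Uniform bound for the Taylor coefficients** `coeff_α p(x + ·)` over the unit sup-norm ball
around `a` (each is a polynomial function of `x`, namely `∂^α p(x)/α!`). [folklore] -/
theorem exists_coeff_shift_bound (p : MvPolynomial (Fin k) ℝ) (a : Fin k → ℝ) :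
    ∃ K : ℝ, 0 ≤ K ∧ ∀ x : Fin k → ℝ, dist x a ≤ 1 → ∀ α : Fin k →₀ ℕ, |coeff α (shift x p)| ≤ K := by
  classical
  have hform : ∀ α : Fin k →₀ ℕ, ∃ (Q : MvPolynomial (Fin k) ℝ) (c : ℝ),
      ∀ x, coeff α (shift x p) = c * MvPolynomial.eval x Q := by
    intro α
    obtain ⟨w, hw, -⟩ := exists_counts_eq α
    refine ⟨iterD (dmap fun i : Fin k => pderiv (R := ℝ) i) w p, ((taylorFactor w 0 : ℕ) : ℝ)⁻¹,
      fun x => ?_⟩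
    have h := coeff_iterD_pderiv w 0 (shift x p)
    rw [zero_add, hw, ← shift_iterD_pderiv, coeff_zero_shift] at h
    have htf : ((taylorFactor w 0 : ℕ) : ℝ) ≠ 0 := by exact_mod_cast (taylorFactor_pos w 0).ne'
    rw [h, ← mul_assoc, inv_mul_cancel₀ htf, one_mul]
  have hper : ∀ α : Fin k →₀ ℕ, ∃ Kα : ℝ, 0 ≤ Kα ∧ ∀ x, dist x a ≤ 1 → |coeff α (shift x p)| ≤ Kα := by
    intro α
    obtain ⟨Q, c, hQ⟩ := hform α
    obtain ⟨B, hB⟩ := (isCompact_closedBall a 1).exists_bound_of_continuousOn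
      ((continuous_const.mul (continuous_eval Q)).continuousOn (s := Metric.closedBall a 1))
    refine ⟨max B 0, le_max_right _ _, fun x hx => ?_⟩
    rw [hQ x]
    exact ((Real.norm_eq_abs _).symm.le.trans (hB x (Metric.mem_closedBall.2 hx))).trans (le_max_left _ _)
  choose Kα hKα0 hKα using hper
  refine ⟨∑ β : BoxIdx k p.totalDegree, Kα β.toExp, Finset.sum_nonneg fun β _ => hKα0 _,
    fun x hx α => ?_⟩
  by_cases hα : α ∈ (shift x p).support
  · have hbox : ∀ i, α i ≤ p.totalDegree := fun i =>
      ((apply_le_degreeOf hα i).trans (degreeOf_le_totalDegree _ i)).trans (totalDegree_shift_le x p)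
    calc |coeff α (shift x p)| ≤ Kα α := hKα α x hx
      _ = Kα (BoxIdx.ofExp p.totalDegree α hbox).toExp := by rw [BoxIdx.toExp_ofExp]
      _ ≤ ∑ β : BoxIdx k p.totalDegree, Kα β.toExp :=
          Finset.single_le_sum (fun β _ => hKα0 _) (Finset.mem_univ _)
  · rw [notMem_support_iff.1 hα, abs_zero]
    exact Finset.sum_nonneg fun β _ => hKα0 _

end Modifier

/-! ### The unit-ball polynomial and the Taylor polynomials: small facts -/

section BallFacts

/-- [folklore] -/
theorem unitBallPoly_eq_ballPoly : unitBallPoly (Fin k) = ballPoly (0 : Fin k → ℝ) 1 := by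
  simp [unitBallPoly, ballPoly]

/-- [folklore] -/
theorem totalDegree_unitBallPoly_le : (unitBallPoly (Fin k)).totalDegree ≤ 2 := by
  rw [unitBallPoly]
  refine (totalDegree_sub _ _).trans (max_le (by rw [totalDegree_one]; exact Nat.zero_le _) ?_)
  exact totalDegree_finsetSum_le fun i _ => by rw [totalDegree_X_pow]

/-- [folklore] -/
theorem eval_pderiv_unitBallPoly (w : Fin k → ℝ) (j : Fin k) :
    MvPolynomial.eval w (pderiv j (unitBallPoly (Fin k))) = -2 * w j := by
  classical
  have h : ∀ x : Fin k, pderiv j ((X x : MvPolynomial (Fin k) ℝ) ^ 2) = if x = j then 2 * X j else 0 := by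
    intro x
    rw [sq, Derivation.leibniz, pderiv_X, Pi.single_apply, smul_eq_mul]
    split_ifs with hxj
    · subst hxj; ring
    · simp
  rw [unitBallPoly, map_sub, Derivation.map_one_eq_zero, map_sum, zero_sub, map_neg]
  simp only [h, Finset.sum_ite_eq', Finset.mem_univ, if_true, map_mul, eval_X]
  simp only [map_ofNat]
  ring

/-- [folklore] -/
theorem gradForm_unitBallPoly (w d : Fin k → ℝ) :
    gradForm (unitBallPoly (Fin k)) w d = -2 * ∑ j, w j * d j := by
  change ∑ j, d j * MvPolynomial.eval w (pderiv j (unitBallPoly (Fin k))) = _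
  simp only [eval_pderiv_unitBallPoly, Finset.mul_sum]
  exact Finset.sum_congr rfl fun j _ => by ring

/-- Chain rule for the scaling. [folklore] -/
theorem pderiv_scalePoly (ε : ℝ) (f : MvPolynomial (Fin k) ℝ) (j : Fin k) :
    pderiv j (scalePoly ε f) = C ε * scalePoly ε (pderiv j f) := by
  classical
  induction f using MvPolynomial.induction_on with
  | C a => simp
  | add p q hp hq => rw [map_add, map_add, hp, hq, map_add, map_add, mul_add]
  | mul_X p i hp =>
    have hs : scalePoly ε (Pi.single (M := fun _ => MvPolynomial (Fin k) ℝ) j 1 i) =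
        Pi.single (M := fun _ => MvPolynomial (Fin k) ℝ) j 1 i := by
      rcases eq_or_ne i j with rfl | hij
      · rw [Pi.single_eq_same, map_one]
      · rw [Pi.single_eq_of_ne hij, map_zero]
    rw [map_mul, scalePoly_X, pderiv_mul, hp, pderiv_C_mul, pderiv_X, pderiv_mul, pderiv_X, map_add,
      map_mul, map_mul, scalePoly_X, hs]
    ring

/-- `∂ⱼ [p(x + ε ·)](w) = ε ∂ⱼp(x + εw)`. [folklore] -/
theorem eval_pderiv_taylorAt (x : Fin k → ℝ) (ε : ℝ) (p : MvPolynomial (Fin k) ℝ) (j : Fin k)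
    (w : Fin k → ℝ) :
    MvPolynomial.eval w (pderiv j (taylorAt x ε p)) = ε * MvPolynomial.eval (x + ε • w) (pderiv j p) := by
  rw [taylorAt, pderiv_scalePoly, map_mul, eval_C, ← shift_pderiv, ← taylorAt, eval_taylorAt]

/-- The quadratic part of the shifted ball polynomial is `-Σ Xᵢ²`. [folklore] -/
theorem homogeneousComponent_two_shift_unitBallPoly (w : Fin k → ℝ) :
    homogeneousComponent 2 (shift w (unitBallPoly (Fin k))) = -∑ i, (X i : MvPolynomial (Fin k) ℝ) ^ 2 := by
  refine MvPolynomial.funext fun v => ?_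
  rw [eval_homogeneousComponent_eq_coeff_linePoly, linePoly_shift, zero_add, unitBallPoly_eq_ballPoly,
    coeff_two_linePoly_ballPoly]
  simp

/-- `coeff 2 (P²) = (coeff 1 P)²` when `P(0) = 0`. [folklore] -/
theorem coeff_two_sq_of_coeff_zero {P : ℝ[X]} (h0 : P.coeff 0 = 0) : (P ^ 2).coeff 2 = (P.coeff 1) ^ 2 := by
  rw [sq, Polynomial.coeff_mul,
    Finset.Nat.sum_antidiagonal_eq_sum_range_succ (fun i j => P.coeff i * P.coeff j) 2]
  simp [Finset.sum_range_succ, h0, sq]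

end BallFacts

/-! ### The certificate of a supporting functional (Helton–Nie's Lemma 8/19 + perturbation) -/

section Certificate

/-- **The sums-of-squares certificate of a supporting functional on a small scaled piece.**
Let `p_w = p(a' + ε ·)` and `q = 1 - Σ wᵢ²`, and let `c` be a linear functional with Lagrange
multipliers `l₁, l₂ ≥ 0` at a point `w` of the unit ball (`c(eⱼ) = l₁ ∂ⱼp_w(w) + l₂ ∂ⱼq(w)`,
complementary slackness). If `-½∇²p ⪰ λ` on the sup-norm ball of radius `ε` around `a'`, the
Taylor coefficients of `p` are bounded by `K` on the unit ball around `a'`, and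
`ε K (D₀+1)^k 2^{D₀} ≤ λ`, then
`Σⱼ c(eⱼ)(Xⱼ - wⱼ) - l₁ p_w - l₂ q ∈ InQM D₀ q`: in coordinates `v = X - w` this polynomial has no
terms of degree `≤ 1` (Helton–Nie, Lemma 8: `f(x) = (x-u)ᵀF(x-u)`), its quadratic part is
`l₁ ε²(-½∇²p(x*)) + l₂ Σvᵢ²` and its higher part is `O(l₁ ε³)`, so the perturbation lemma applies.
[cite: HeltonNie2008, Lemma 8 and Lemma 19] -/
theorem inQM_certificate {p : MvPolynomial (Fin k) ℝ} {a' : Fin k → ℝ} {ε lam K : ℝ} {D₀ : ℕ}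
    (hε0 : 0 < ε) (hε1 : ε ≤ 1) (hD₀ : 2 ≤ D₀) (hdeg : p.totalDegree ≤ D₀) (hlam : 0 < lam)
    (hHess : ∀ x : Fin k → ℝ, dist x a' ≤ ε → ∀ v : Fin k → ℝ, lam * ∑ i, v i ^ 2 ≤ -(linePoly p x v).coeff 2)
    (hK : ∀ x : Fin k → ℝ, dist x a' ≤ 1 → ∀ α : Fin k →₀ ℕ, |coeff α (shift x p)| ≤ K)
    (hsmall : ε * (K * ((D₀ + 1) ^ k * (2 : ℝ) ^ D₀)) ≤ lam)
    {w : Fin k → ℝ} (hw : ∑ i, w i ^ 2 ≤ 1) {c : (Fin k → ℝ) →ₗ[ℝ] ℝ} {l₁ l₂ : ℝ} (hl₁ : 0 ≤ l₁)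
    (hl₂ : 0 ≤ l₂) (hs₁ : l₁ * MvPolynomial.eval w (taylorAt a' ε p) = 0)
    (hs₂ : l₂ * MvPolynomial.eval w (unitBallPoly (Fin k)) = 0)
    (hgradeq : ∀ j, c (Pi.single j 1) = l₁ * MvPolynomial.eval w (pderiv j (taylorAt a' ε p)) +
      l₂ * MvPolynomial.eval w (pderiv j (unitBallPoly (Fin k)))) :
    InQM D₀ (unitBallPoly (Fin k))
      (∑ j, C (c (Pi.single j 1)) * (X j - C (w j)) - C l₁ * taylorAt a' ε p -
        C l₂ * unitBallPoly (Fin k)) := by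
  classical
  -- notation
  obtain ⟨ℓ, hℓ⟩ : ∃ ℓ : MvPolynomial (Fin k) ℝ, ℓ = ∑ j, C (c (Pi.single j 1)) * (X j - C (w j)) := ⟨_, rfl⟩
  obtain ⟨f, hf⟩ : ∃ f : MvPolynomial (Fin k) ℝ,
      f = ℓ - C l₁ * taylorAt a' ε p - C l₂ * unitBallPoly (Fin k) := ⟨_, rfl⟩
  rw [← hℓ, ← hf]
  -- reduce to the shifted statement
  suffices h : InQM D₀ (shift w (unitBallPoly (Fin k))) (shift w f) by
    have := h.shift_mem (-w)
    rwa [shift_shift, shift_shift, neg_add_cancel, shift_zero, shift_zero] at this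
  -- the shifted data
  obtain ⟨x', hx'⟩ : ∃ x' : Fin k → ℝ, x' = a' + ε • w := ⟨_, rfl⟩
  obtain ⟨P, hP⟩ : ∃ P : MvPolynomial (Fin k) ℝ, P = taylorAt x' ε p := ⟨_, rfl⟩
  have hpt : shift w (taylorAt a' ε p) = P := by rw [hP, hx', shift_taylorAt]
  have hwn : ‖w‖ ≤ 1 := by
    refine (pi_norm_le_iff_of_nonneg zero_le_one).2 fun i => ?_
    rw [Real.norm_eq_abs, ← sq_le_one_iff_abs_le_one]
    exact (Finset.single_le_sum (fun j _ => sq_nonneg (w j)) (Finset.mem_univ i)).trans hw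
  have hdist : dist x' a' ≤ ε := by
    rw [hx', dist_eq_norm, add_sub_cancel_left, norm_smul, Real.norm_eq_abs, abs_of_pos hε0]
    exact mul_le_of_le_one_right hε0.le hwn
  have hdist1 : dist x' a' ≤ 1 := hdist.trans hε1
  have hF : shift w f = shift w ℓ - C l₁ * P - C l₂ * shift w (unitBallPoly (Fin k)) := by
    rw [hf, map_sub, map_sub, map_mul, map_mul, shift_C, shift_C, hpt]
  -- low-order coefficients of the shifted polynomial vanish (complementary slackness, KKT)
  have hevalℓ : MvPolynomial.eval w ℓ = 0 := by
    rw [hℓ, map_sum]; exact Finset.sum_eq_zero fun j _ => by simp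
  have hpdℓ : ∀ i, MvPolynomial.eval w (pderiv i ℓ) = c (Pi.single i 1) := by
    intro i
    rw [hℓ, map_sum, map_sum]
    rw [Finset.sum_eq_single i]
    · rw [Derivation.leibniz, pderiv_C, smul_zero, add_zero, map_sub, pderiv_C, sub_zero, pderiv_X,
        Pi.single_eq_same]; simp
    · intro j _ hji
      rw [Derivation.leibniz, pderiv_C, smul_zero, add_zero, map_sub, pderiv_C, sub_zero, pderiv_X,
        Pi.single_eq_of_ne hji]; simp
    · intro h; exact absurd (Finset.mem_univ i) h
  have hF0 : coeff 0 (shift w f) = 0 := by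
    rw [coeff_zero_shift, hf, map_sub, map_sub, map_mul, map_mul, eval_C, eval_C, hevalℓ, hs₁, hs₂]; ring
  have hF1 : ∀ i, coeff (Finsupp.single i 1) (shift w f) = 0 := by
    intro i
    rw [coeff_single_shift, hf]
    simp only [map_sub, pderiv_C_mul, map_mul, eval_C]
    rw [hpdℓ, hgradeq i]; ring
  -- degrees
  have hdegℓ : (shift w ℓ).totalDegree ≤ 1 := by
    refine (totalDegree_shift_le _ _).trans ?_
    rw [hℓ]
    refine totalDegree_finsetSum_le fun j _ => (totalDegree_C_mul_le' _ _).trans ?_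
    exact (totalDegree_sub_C_le _ _).trans (by rw [totalDegree_X])
  have hdegq : (shift w (unitBallPoly (Fin k))).totalDegree ≤ 2 :=
    (totalDegree_shift_le _ _).trans totalDegree_unitBallPoly_le
  have hdegP : P.totalDegree ≤ D₀ := by rw [hP]; exact (totalDegree_taylorAt_le _ _ _).trans hdeg
  have hdegF : (shift w f).totalDegree ≤ D₀ := by
    rw [hF]
    refine (totalDegree_sub _ _).trans (max_le ((totalDegree_sub _ _).trans (max_le ?_ ?_)) ?_)
    · exact hdegℓ.trans (by omega)
    · exact (totalDegree_C_mul_le' _ _).trans hdegP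
    · exact (totalDegree_C_mul_le' _ _).trans (hdegq.trans hD₀)
  -- decomposition of the shifted polynomial
  have hdec := eq_sum_homogeneousComponent_add_highPart (shift w f) hdegF
  rw [homogeneousComponent_zero_eq_zero hF0, homogeneousComponent_one_eq_zero hF1, zero_add, zero_add]
    at hdec
  have h2 : homogeneousComponent 2 (shift w f) =
      -(C l₁ * homogeneousComponent 2 P) + C l₂ * ∑ i, (X i : MvPolynomial (Fin k) ℝ) ^ 2 := by
    rw [hF, map_sub, map_sub, homogeneousComponent_C_mul, homogeneousComponent_C_mul,
      homogeneousComponent_eq_zero 2 (shift w ℓ) (by omega), homogeneousComponent_two_shift_unitBallPoly]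
    ring
  have h3 : highPart D₀ (shift w f) = -(C l₁ * highPart D₀ P) := by
    rw [hF, highPart_sub, highPart_sub, highPart_C_mul, highPart_C_mul,
      highPart_eq_zero_of_totalDegree_le D₀ (hdegℓ.trans one_le_two),
      highPart_eq_zero_of_totalDegree_le D₀ hdegq]
    ring
  -- the Hessian matrix of `P` at the origin
  let Hm : Matrix (Fin k) (Fin k) ℝ := Matrix.of fun i j =>
    -(1 / 4 : ℝ) * (MvPolynomial.eval 0 (pderiv i (pderiv j P)) + MvPolynomial.eval 0 (pderiv j (pderiv i P)))
  have hHsymm : Hm.IsSymm := by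
    ext i j; simp only [Hm, Matrix.transpose_apply, Matrix.of_apply]; ring
  have hquad : ∀ v : Fin k → ℝ, ∑ i, ∑ j, Hm i j * v i * v j = -(linePoly P 0 v).coeff 2 := by
    intro v
    have h2c := two_mul_coeff_two_linePoly P 0 v
    have hswap : ∑ i, ∑ j, v i * v j * MvPolynomial.eval 0 (pderiv j (pderiv i P)) =
        ∑ i, ∑ j, v i * v j * MvPolynomial.eval 0 (pderiv i (pderiv j P)) := by
      rw [Finset.sum_comm]
      exact Finset.sum_congr rfl fun i _ => Finset.sum_congr rfl fun j _ => by ring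
    have hL : ∑ i, ∑ j, Hm i j * v i * v j =
        -(1 / 4 : ℝ) * (∑ i, ∑ j, v i * v j * MvPolynomial.eval 0 (pderiv i (pderiv j P)) +
          ∑ i, ∑ j, v i * v j * MvPolynomial.eval 0 (pderiv j (pderiv i P))) := by
      rw [← Finset.sum_add_distrib, Finset.mul_sum]
      refine Finset.sum_congr rfl fun i _ => ?_
      rw [← Finset.sum_add_distrib, Finset.mul_sum]
      exact Finset.sum_congr rfl fun j _ => by simp only [Hm, Matrix.of_apply]; ring
    rw [hL, hswap, ← h2c]; ring
  have hquadPoly : quadPoly Hm = -homogeneousComponent 2 P := by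
    refine MvPolynomial.funext fun v => ?_
    rw [eval_quadPoly, map_neg, eval_homogeneousComponent_eq_coeff_linePoly, hquad]
  have hHpos : ∀ v : Fin k → ℝ, ε ^ 2 * lam * ∑ i, v i ^ 2 ≤ ∑ i, ∑ j, Hm i j * v i * v j := by
    intro v
    rw [hquad, hP, linePoly_taylorAt, coeff_two_linePoly_smul]
    have := mul_le_mul_of_nonneg_left (hHess x' hdist v) (sq_nonneg ε)
    linarith
  have hA : (Hm - (ε ^ 2 * lam) • (1 : Matrix (Fin k) (Fin k) ℝ)).PosSemidef :=
    posSemidef_sub_smul_one hHsymm hHpos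
  -- the higher-order part
  obtain ⟨Φ₃, hΦ₃⟩ : ∃ Φ₃ : MvPolynomial (Fin k) ℝ, Φ₃ = -highPart D₀ P := ⟨_, rfl⟩
  have hΦ3supp : ∀ α ∈ Φ₃.support, 3 ≤ α.degree := fun α hα =>
    three_le_of_mem_support_highPart (f := P) (R := D₀) (by rwa [hΦ₃, support_neg] at hα)
  have hΦ3deg : Φ₃.totalDegree ≤ D₀ := by rw [hΦ₃, totalDegree_neg]; exact totalDegree_highPart_le _ _
  have hΦ3small : ∀ α ∈ Φ₃.support,
      |coeff α Φ₃| * ((D₀ + 1) ^ Fintype.card (Fin k) * (2 : ℝ) ^ D₀) ≤ ε ^ 2 * lam := by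
    intro α hα
    have h3 := hΦ3supp α hα
    have hαD : α.degree ≤ D₀ := (le_totalDegree hα).trans hΦ3deg
    rw [Fintype.card_fin]
    have hc : coeff α Φ₃ = -coeff α P := by
      rw [hΦ₃, coeff_neg, coeff_highPart, if_pos ⟨h3, hαD⟩]
    rw [hc, abs_neg, hP, coeff_taylorAt, abs_mul, abs_pow, abs_of_pos hε0]
    have hKα := hK x' hdist1 α
    have hεpow : ε ^ α.degree ≤ ε ^ 3 := pow_le_pow_of_le_one hε0.le hε1 h3
    have hK0 : 0 ≤ K := (abs_nonneg _).trans hKα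
    calc ε ^ α.degree * |coeff α (shift x' p)| * ((D₀ + 1) ^ k * (2 : ℝ) ^ D₀)
        ≤ ε ^ 3 * K * ((D₀ + 1) ^ k * (2 : ℝ) ^ D₀) := by
          refine mul_le_mul_of_nonneg_right ?_ (by positivity)
          exact mul_le_mul hεpow hKα (abs_nonneg _) (by positivity)
      _ = ε ^ 2 * (ε * (K * ((D₀ + 1) ^ k * (2 : ℝ) ^ D₀))) := by ring
      _ ≤ ε ^ 2 * lam := mul_le_mul_of_nonneg_left hsmall (sq_nonneg ε)
  -- the perturbation lemma
  have hpert : InQM D₀ (shift w (unitBallPoly (Fin k))) (quadPoly Hm + Φ₃) :=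
    InQM.of_quadratic_perturbation (by positivity) hA hD₀ hΦ3supp hΦ3deg hΦ3small w hw
  -- assemble
  have hFeq : shift w f = C l₁ * (quadPoly Hm + Φ₃) + C l₂ * ∑ i, (X i : MvPolynomial (Fin k) ℝ) ^ 2 := by
    rw [hdec, h2, h3, hquadPoly, hΦ₃]; ring
  rw [hFeq]
  refine (hpert.smul hl₁).add ?_
  rw [Finset.mul_sum]
  exact InQM.sum _ _ fun i _ => (InQM.sq (X i) (by rw [totalDegree_X]; omega)).smul hl₂

end Certificate

/-! ### The local step: a small Euclidean ball around a smooth s.q.c. boundary point -/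

section Local

/-- **The local step of Netzer–Sanyal's proof without Helton–Nie's theorem.** Let `S' ⊆ ℝᵏ` be
convex, `a'` a point with `g(a') = 0`, `∇g(a') ≠ 0`, `g` strictly
quasi-concave at `a'`, and `S' = {g ≥ 0}` inside the Euclidean ball of radius `δ` around `a'`.
Then for some `ε > 0` the set `S' ∩ B̄(a', ε)` is a spectrahedral shadow. (Helton–Nie obtain this
for ANY such ball from their Theorem 2 via Positivstellensätze with degree bounds
(HN 2009, proof of Thm 3.3); here the ball is taken small enough that the order-`D₀` moment
relaxation is already exact, `D₀ = max(2 deg g, 2)`, by `inQM_certificate`.)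
[cite: NetzerSanyal2014, proof of Theorem 3.1] [cite: HeltonNie2009, Theorem 3.3] -/
theorem exists_isSpectrahedralShadow_inter_ball {S' : Set (Fin k → ℝ)} {g : MvPolynomial (Fin k) ℝ}
    (hS'convex : Convex ℝ S') {a' : Fin k → ℝ}
    (hga' : MvPolynomial.eval a' g = 0) (hgrad : gradForm g a' ≠ 0)
    (hsqc : IsStrictlyQuasiConcaveAt g a') {δ : ℝ} (hδ : 0 < δ)
    (hiff : ∀ y, ∑ i, (y i - a' i) ^ 2 ≤ δ ^ 2 → (y ∈ S' ↔ 0 ≤ MvPolynomial.eval y g)) :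
    ∃ ε : ℝ, 0 < ε ∧ IsSpectrahedralShadow (S' ∩ {y | ∑ i, (y i - a' i) ^ 2 ≤ ε ^ 2}) := by
  classical
  -- (1) the modified defining polynomial `p = g - M g²`
  obtain ⟨M, hM0, lam, hlam, hfin⟩ := exists_modifier hsqc
  obtain ⟨p, hp⟩ : ∃ p : MvPolynomial (Fin k) ℝ, p = g - C M * g ^ 2 := ⟨_, rfl⟩
  have hpeval : ∀ x, MvPolynomial.eval x p = MvPolynomial.eval x g * (1 - M * MvPolynomial.eval x g) := by
    intro x; rw [hp, map_sub, map_mul, map_pow, eval_C]; ring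
  have hpa' : MvPolynomial.eval a' p = 0 := by rw [hpeval, hga']; ring
  have hplp : ∀ v, (linePoly p a' v).coeff 2 =
      (linePoly g a' v).coeff 2 - M * ((linePoly g a' v).coeff 1) ^ 2 := by
    intro v
    have hlp : linePoly p a' v = linePoly g a' v - Polynomial.C M * (linePoly g a' v) ^ 2 := by
      simp only [hp, linePoly, map_sub, map_mul, map_pow, MvPolynomial.aeval_C, Polynomial.algebraMap_eq]
    have h0 : (linePoly g a' v).coeff 0 = 0 := by rw [coeff_zero_linePoly, hga']
    rw [hlp, Polynomial.coeff_sub, Polynomial.coeff_C_mul, coeff_two_sq_of_coeff_zero h0]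
  have hHa : ∀ v : Fin k → ℝ, 2 * (lam / 2) * ∑ i, v i ^ 2 ≤ -(linePoly p a' v).coeff 2 := by
    intro v; rw [hplp]; have := hfin v; linarith
  -- (2) uniform negative definiteness of the Hessian of `p` near `a'`
  obtain ⟨ρ₁, hρ₁, hHess⟩ := exists_ball_coeff_two_le (half_pos hlam) hHa
  -- (3) uniform bound for the Taylor coefficients of `p`
  obtain ⟨K, hK0, hK⟩ := exists_coeff_shift_bound p a'
  -- (4) `M g < 1` near `a'`
  obtain ⟨ρ₂, hρ₂, hgsmall⟩ : ∃ ρ₂ : ℝ, 0 < ρ₂ ∧ ∀ x, dist x a' ≤ ρ₂ → M * MvPolynomial.eval x g < 1 := by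
    have hc : Continuous fun x : Fin k → ℝ => M * MvPolynomial.eval x g :=
      continuous_const.mul (continuous_eval g)
    have hev : ∀ᶠ x in 𝓝 a', M * MvPolynomial.eval x g < 1 :=
      hc.continuousAt.eventually_lt continuousAt_const (by rw [hga', mul_zero]; exact one_pos)
    obtain ⟨r, hr, hball⟩ := Metric.eventually_nhds_iff.1 hev
    exact ⟨r / 2, half_pos hr, fun x hx => hball (lt_of_le_of_lt hx (half_lt_self hr))⟩
  -- (5) `∇g ≠ 0` near `a'`
  obtain ⟨ρ₃, hρ₃, hgradnz⟩ : ∃ ρ₃ : ℝ, 0 < ρ₃ ∧ ∀ x, dist x a' ≤ ρ₃ → gradForm g x ≠ 0 := by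
    obtain ⟨v, hv⟩ : ∃ v, gradForm g a' v ≠ 0 := by
      by_contra hall; push Not at hall; exact hgrad (LinearMap.ext hall)
    have hc : Continuous fun x : Fin k → ℝ => gradForm g x v := by
      change Continuous fun x : Fin k → ℝ => ∑ j, v j * MvPolynomial.eval x (pderiv j g)
      exact continuous_finsetSum _ fun j _ => continuous_const.mul (continuous_eval _)
    have hev : ∀ᶠ x in 𝓝 a', gradForm g x v ≠ 0 := hc.continuousAt.eventually_ne hv
    obtain ⟨r, hr, hball⟩ := Metric.eventually_nhds_iff.1 hev
    exact ⟨r / 2, half_pos hr, fun x hx h0 =>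
      hball (lt_of_le_of_lt hx (half_lt_self hr)) (by rw [h0, LinearMap.zero_apply])⟩
  -- (6) the radius
  obtain ⟨D₀, hD₀⟩ : ∃ D₀ : ℕ, D₀ = max p.totalDegree 2 := ⟨_, rfl⟩
  have hD₀2 : 2 ≤ D₀ := by rw [hD₀]; exact le_max_right _ _
  have hD₀p : p.totalDegree ≤ D₀ := by rw [hD₀]; exact le_max_left _ _
  obtain ⟨Nc, hNc⟩ : ∃ Nc : ℝ, Nc = K * ((D₀ + 1) ^ k * (2 : ℝ) ^ D₀) := ⟨_, rfl⟩
  have hNc0 : 0 ≤ Nc := by rw [hNc]; positivity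
  obtain ⟨ε, hε⟩ : ∃ ε : ℝ,
      ε = min (min (min 1 δ) (min ρ₁ ρ₂)) (min ρ₃ (lam / (2 * (Nc + 1)))) / 2 := ⟨_, rfl⟩
  have hm : 0 < min (min (min 1 δ) (min ρ₁ ρ₂)) (min ρ₃ (lam / (2 * (Nc + 1)))) :=
    lt_min (lt_min (lt_min one_pos hδ) (lt_min hρ₁ hρ₂)) (lt_min hρ₃ (by positivity))
  have hεpos : 0 < ε := by rw [hε]; exact half_pos hm
  have hεle : ∀ t : ℝ, min (min (min 1 δ) (min ρ₁ ρ₂)) (min ρ₃ (lam / (2 * (Nc + 1)))) ≤ t → ε ≤ t := by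
    intro t ht; rw [hε]; linarith [hm]
  have hε1 : ε ≤ 1 := hεle 1 (by simp)
  have hεδ : ε ≤ δ := hεle δ (by simp)
  have hερ₁ : ε ≤ ρ₁ := hεle ρ₁ (by simp)
  have hερ₂ : ε ≤ ρ₂ := hεle ρ₂ (by simp)
  have hερ₃ : ε ≤ ρ₃ := hεle ρ₃ (by simp)
  have hεsmall : ε * Nc ≤ lam / 2 := by
    have h1 : ε ≤ lam / (2 * (Nc + 1)) := hεle _ (by simp)
    calc ε * Nc ≤ lam / (2 * (Nc + 1)) * Nc := mul_le_mul_of_nonneg_right h1 hNc0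
      _ ≤ lam / 2 := by
          rw [div_mul_eq_mul_div, div_le_div_iff₀ (by positivity) two_pos]; nlinarith
  refine ⟨ε, hεpos, ?_⟩
  -- (7) the scaled piece `N_w = {w | p(a' + εw) ≥ 0, 1 - |w|² ≥ 0}`
  obtain ⟨Nw, hNw⟩ : ∃ Nw : Set (Fin k → ℝ), Nw = {w | 0 ≤ MvPolynomial.eval w (taylorAt a' ε p) ∧
      0 ≤ MvPolynomial.eval w (unitBallPoly (Fin k))} := ⟨_, rfl⟩
  have hmemNw : ∀ w, w ∈ Nw ↔ 0 ≤ MvPolynomial.eval w (taylorAt a' ε p) ∧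
      0 ≤ MvPolynomial.eval w (unitBallPoly (Fin k)) := fun w => by rw [hNw]; rfl
  have hnorm : ∀ w : Fin k → ℝ, ∑ i, w i ^ 2 ≤ 1 → ‖w‖ ≤ 1 := by
    intro w hw
    refine (pi_norm_le_iff_of_nonneg zero_le_one).2 fun i => ?_
    rw [Real.norm_eq_abs, ← sq_le_one_iff_abs_le_one]
    exact (Finset.single_le_sum (fun j _ => sq_nonneg (w j)) (Finset.mem_univ i)).trans hw
  have hdistw : ∀ w : Fin k → ℝ, ∑ i, w i ^ 2 ≤ 1 → dist (a' + ε • w) a' ≤ ε := by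
    intro w hw
    rw [dist_eq_norm, add_sub_cancel_left, norm_smul, Real.norm_eq_abs, abs_of_pos hεpos]
    exact mul_le_of_le_one_right hεpos.le (hnorm w hw)
  have hsqw : ∀ w : Fin k → ℝ, ∑ i, ((a' + ε • w) i - a' i) ^ 2 = ε ^ 2 * ∑ i, w i ^ 2 := by
    intro w; rw [Finset.mul_sum]; exact Finset.sum_congr rfl fun i _ => by simp [mul_pow]
  have hqw : ∀ w : Fin k → ℝ, 0 ≤ MvPolynomial.eval w (unitBallPoly (Fin k)) ↔ ∑ i, w i ^ 2 ≤ 1 := by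
    intro w; rw [eval_unitBallPoly, sub_nonneg]
  have hpos1 : ∀ w : Fin k → ℝ, ∑ i, w i ^ 2 ≤ 1 → 0 < 1 - M * MvPolynomial.eval (a' + ε • w) g := by
    intro w hw; have := hgsmall _ ((hdistw w hw).trans hερ₂); linarith
  have hballδ : ∀ w : Fin k → ℝ, ∑ i, w i ^ 2 ≤ 1 → ∑ i, ((a' + ε • w) i - a' i) ^ 2 ≤ δ ^ 2 := by
    intro w hw
    rw [hsqw]
    calc ε ^ 2 * ∑ i, w i ^ 2 ≤ ε ^ 2 * 1 := mul_le_mul_of_nonneg_left hw (sq_nonneg ε)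
      _ ≤ δ ^ 2 := by rw [mul_one]; exact pow_le_pow_left₀ hεpos.le hεδ 2
  have hkey : ∀ w : Fin k → ℝ,
      w ∈ Nw ↔ a' + ε • w ∈ S' ∧ ∑ i, ((a' + ε • w) i - a' i) ^ 2 ≤ ε ^ 2 := by
    intro w
    rw [hmemNw]
    constructor
    · rintro ⟨hpw, hq⟩
      have hw1 := (hqw w).1 hq
      have hball : ∑ i, ((a' + ε • w) i - a' i) ^ 2 ≤ ε ^ 2 := by
        rw [hsqw]; exact mul_le_of_le_one_right (sq_nonneg ε) hw1
      refine ⟨?_, hball⟩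
      rw [hiff _ (hballδ w hw1)]
      have hpx : 0 ≤ MvPolynomial.eval (a' + ε • w) p := by rw [← eval_taylorAt]; exact hpw
      rw [hpeval] at hpx
      exact (mul_nonneg_iff_of_pos_right (hpos1 w hw1)).1 hpx
    · rintro ⟨hS, hball⟩
      have hw1 : ∑ i, w i ^ 2 ≤ 1 := by
        rw [hsqw] at hball
        by_contra hlt
        push Not at hlt
        have : ε ^ 2 * 1 < ε ^ 2 * ∑ i, w i ^ 2 := mul_lt_mul_of_pos_left hlt (by positivity)
        linarith
      refine ⟨?_, (hqw w).2 hw1⟩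
      have hg : 0 ≤ MvPolynomial.eval (a' + ε • w) g := (hiff _ (hballδ w hw1)).1 hS
      rw [eval_taylorAt, hpeval]
      exact mul_nonneg hg (hpos1 w hw1).le
  -- (8) the original piece is an affine image of `N_w`
  have hset : S' ∩ {y | ∑ i, (y i - a' i) ^ 2 ≤ ε ^ 2} =
      (fun w => (ε • LinearMap.id : (Fin k → ℝ) →ₗ[ℝ] (Fin k → ℝ)) w + a') '' Nw := by
    ext y
    simp only [Set.mem_inter_iff, Set.mem_setOf_eq, Set.mem_image, LinearMap.smul_apply,
      LinearMap.id_apply]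
    constructor
    · rintro ⟨hyS, hyb⟩
      refine ⟨ε⁻¹ • (y - a'), ?_, ?_⟩
      · rw [hkey]
        have : a' + ε • (ε⁻¹ • (y - a')) = y := by
          rw [smul_smul, mul_inv_cancel₀ hεpos.ne', one_smul, add_sub_cancel]
        rw [this]; exact ⟨hyS, hyb⟩
      · rw [smul_smul, mul_inv_cancel₀ hεpos.ne', one_smul, sub_add_cancel]
    · rintro ⟨w, hw, rfl⟩
      rw [add_comm]; exact (hkey w).1 hw
  rw [hset]
  refine IsSpectrahedralShadow.affine_image ?_ _ _
  -- (9) `N_w` is a spectrahedral shadow: exactness of the moment relaxation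
  have h0Nw : (0 : Fin k → ℝ) ∈ Nw := by
    rw [hmemNw, eval_taylorAt, smul_zero, add_zero, hpa', eval_unitBallPoly]
    simp
  have hNwcpt : IsCompact Nw := by
    refine Metric.isCompact_of_isClosed_isBounded ?_ ?_
    · rw [hNw]
      exact (isClosed_le continuous_const (continuous_eval _)).inter
        (isClosed_le continuous_const (continuous_eval _))
    · refine (Metric.isBounded_closedBall (x := (0 : Fin k → ℝ)) (r := 1)).subset fun w hw => ?_
      rw [Metric.mem_closedBall, dist_zero_right]
      exact hnorm w ((hqw w).1 ((hmemNw w).1 hw).2)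
  have hNwconv : Convex ℝ Nw := by
    have hc : Convex ℝ (S' ∩ {y : Fin k → ℝ | ∑ i, (y i - a' i) ^ 2 ≤ ε ^ 2}) :=
      hS'convex.inter (convex_sumSq_le a' _)
    have h2 := (hc.translate_preimage_right a').linear_preimage
      (ε • LinearMap.id : (Fin k → ℝ) →ₗ[ℝ] (Fin k → ℝ))
    have hNwS : Nw = (ε • LinearMap.id : (Fin k → ℝ) →ₗ[ℝ] (Fin k → ℝ)) ⁻¹'
        ((fun x => a' + x) ⁻¹' (S' ∩ {y : Fin k → ℝ | ∑ i, (y i - a' i) ^ 2 ≤ ε ^ 2})) := by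
      ext w; rw [hkey]; simp
    rw [hNwS]; exact h2
  refine isSpectrahedralShadow_of_certificates (D := D₀) (p := taylorAt a' ε p) (q := unitBallPoly (Fin k))
    hmemNw (fun i => ?_) (fun i => ?_) hNwcpt hNwconv ⟨0, h0Nw⟩ ?_
  · exact (degreeOf_le_totalDegree _ i).trans ((totalDegree_taylorAt_le _ _ _).trans (by omega))
  · exact (degreeOf_le_totalDegree _ i).trans totalDegree_unitBallPoly_le
  -- (10) the certificates of supporting functionals
  intro c w hw hmin
  rw [hmemNw] at hw
  have hw1 : ∑ i, w i ^ 2 ≤ 1 := (hqw w).1 hw.2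
  have hdist : dist (a' + ε • w) a' ≤ ε := hdistw w hw1
  -- the Mangasarian–Fromovitz direction `d₀ = -w + η ∇p_w(w)`
  obtain ⟨Gp, hGp⟩ : ∃ Gp : Fin k → ℝ, Gp = fun j => MvPolynomial.eval w (pderiv j (taylorAt a' ε p)) :=
    ⟨_, rfl⟩
  obtain ⟨η, hη⟩ : ∃ η : ℝ, η = 1 / (2 * (|∑ j, Gp j * w j| + 1)) := ⟨_, rfl⟩
  have hηpos : 0 < η := by rw [hη]; positivity
  obtain ⟨d₀, hd₀⟩ : ∃ d₀ : Fin k → ℝ, d₀ = -w + η • Gp := ⟨_, rfl⟩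
  have hgf_p : ∀ d, gradForm (taylorAt a' ε p) w d = ∑ j, d j * Gp j := fun d => by rw [hGp]; rfl
  have hd₂ : MvPolynomial.eval w (unitBallPoly (Fin k)) = 0 → 0 < gradForm (unitBallPoly (Fin k)) w d₀ := by
    intro hq0
    have hw_eq : ∑ j, w j ^ 2 = 1 := by rw [eval_unitBallPoly] at hq0; linarith
    rw [gradForm_unitBallPoly]
    have hsum : ∑ j, w j * d₀ j = -1 + η * ∑ j, Gp j * w j := by
      rw [hd₀, ← hw_eq, Finset.mul_sum, ← Finset.sum_neg_distrib, ← Finset.sum_add_distrib]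
      exact Finset.sum_congr rfl fun j _ => by simp only [Pi.add_apply, Pi.neg_apply, Pi.smul_apply, smul_eq_mul]; ring
    rw [hsum]
    have hS : |η * ∑ j, Gp j * w j| ≤ 1 / 2 := by
      rw [abs_mul, abs_of_pos hηpos, hη]
      rw [div_mul_eq_mul_div, one_mul, div_le_div_iff₀ (by positivity) two_pos]
      nlinarith [abs_nonneg (∑ j, Gp j * w j)]
    have := abs_le.1 hS
    linarith
  have hd₁ : MvPolynomial.eval w (taylorAt a' ε p) = 0 → 0 < gradForm (taylorAt a' ε p) w d₀ := by
    intro hp0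
    -- the gradient of `p_w` at `w` is non-zero
    have hGne : Gp ≠ 0 := by
      have hpx : MvPolynomial.eval (a' + ε • w) p = 0 := by rw [← eval_taylorAt]; exact hp0
      have hgx : MvPolynomial.eval (a' + ε • w) g = 0 := by
        rw [hpeval] at hpx
        rcases mul_eq_zero.1 hpx with h | h
        · exact h
        · exfalso; have := hpos1 w hw1; linarith
      have hgf := hgradnz _ (hdist.trans hερ₃)
      obtain ⟨j, hj⟩ : ∃ j, MvPolynomial.eval (a' + ε • w) (pderiv j g) ≠ 0 := by
        by_contra hall
        push Not at hall
        refine hgf (LinearMap.ext fun v => ?_)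
        change ∑ j, v j * MvPolynomial.eval (a' + ε • w) (pderiv j g) = 0
        exact Finset.sum_eq_zero fun j _ => by rw [hall j, mul_zero]
      have hpj : MvPolynomial.eval (a' + ε • w) (pderiv j p) = MvPolynomial.eval (a' + ε • w) (pderiv j g) := by
        rw [hp, map_sub, pderiv_C_mul, sq, pderiv_mul, map_sub, map_mul, eval_C, map_add, map_mul, map_mul,
          hgx]
        ring
      intro hG0
      have h1 := congrFun hG0 j
      rw [hGp] at h1
      simp only [Pi.zero_apply] at h1
      rw [eval_pderiv_taylorAt, hpj] at h1
      exact (mul_ne_zero hεpos.ne' hj) h1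
    -- along the segment from `w` to the centre `0 ∈ N_w` the constraint stays `≥ 0`
    have hseg : 0 ≤ gradForm (taylorAt a' ε p) w (-w) := by
      rw [gradForm_apply]
      refine Polynomial.coeff_one_nonneg_of_eventually_nonneg _ ?_ ?_
      · rw [eval_linePoly, zero_smul, add_zero, hp0]
      · filter_upwards [Ioo_mem_nhdsGT (zero_lt_one' ℝ)] with s hs
        rw [eval_linePoly]
        have hmem : (1 - s) • w + s • (0 : Fin k → ℝ) ∈ Nw :=
          hNwconv ((hmemNw w).2 hw) h0Nw (by linarith [hs.2]) hs.1.le (by ring)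
        rw [smul_zero, add_zero, sub_smul, one_smul] at hmem
        rw [show w + s • -w = w - s • w by rw [smul_neg, sub_eq_add_neg]]
        exact ((hmemNw _).1 hmem).1
    have hsum : gradForm (taylorAt a' ε p) w d₀ = gradForm (taylorAt a' ε p) w (-w) + η * ∑ j, Gp j ^ 2 := by
      rw [hgf_p, hgf_p, hd₀, Finset.mul_sum, ← Finset.sum_add_distrib]
      exact Finset.sum_congr rfl fun j _ => by
        simp only [Pi.add_apply, Pi.neg_apply, Pi.smul_apply, smul_eq_mul]; ring
    rw [hsum]
    have hGsq : 0 < ∑ j, Gp j ^ 2 := by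
      obtain ⟨j, hj⟩ := Function.ne_iff.1 hGne
      exact Finset.sum_pos' (fun i _ => sq_nonneg _) ⟨j, Finset.mem_univ _, sq_pos_iff.2 hj⟩
    have := mul_pos hηpos hGsq
    linarith
  obtain ⟨l₁, l₂, hl₁, hl₂, hs₁, hs₂, hgradeq⟩ := exists_multipliers hw.1 hw.2 c
    (fun z h1 h2 => hmin z ((hmemNw z).2 ⟨h1, h2⟩)) d₀ hd₁ hd₂
  refine ⟨l₁, hl₁, fun L hL1 hL2 => ?_⟩
  have hcertif := inQM_certificate hεpos hε1 hD₀2 hD₀p (half_pos hlam)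
    (fun x hx v => hHess x (hx.trans hερ₁) v) hK (by rw [← hNc]; exact hεsmall) hw1 hl₁ hl₂ hs₁ hs₂ hgradeq
  have hsplit : (∑ j, C (c (Pi.single j 1)) * (X j - C (w j)) - C l₁ * taylorAt a' ε p : MvPolynomial (Fin k) ℝ) =
      (∑ j, C (c (Pi.single j 1)) * (X j - C (w j)) - C l₁ * taylorAt a' ε p - C l₂ * unitBallPoly (Fin k)) +
        C l₂ * unitBallPoly (Fin k) := by ring
  rw [hsplit, map_add]
  refine add_nonneg (hcertif.linear_nonneg L hL1 hL2) ?_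
  rw [C_mul', map_smul, smul_eq_mul]
  exact mul_nonneg hl₂ (by simpa using hL2 1 (by simp))

end Local

/-! ### The assembly and the discharge of `NetzerSanyal2014_thm11` -/

section Main

open scoped Matrix

variable {n : ℕ} {f : MvPolynomial (Fin n) ℝ} {d : ℕ} {e : Fin n → ℝ}

/-- **Netzer–Sanyal, Thm 1.1 for degree `≥ 2`** — the assembly of `SmoothConeShadow.lean`
(`isSpectrahedralShadow_hyperbolicityCone_of_two_le`) re-run with the local step supplied by
`exists_isSpectrahedralShadow_inter_ball` instead of Helton–Nie's theorem.
[cite: NetzerSanyal2014, Theorem 1.1 and proof of Theorem 3.1] -/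
theorem isSpectrahedralShadow_hyperbolicityCone_of_two_le'
    (hf : f.IsHomogeneous d) (he : IsHyperbolic f e) (hpos : 0 < MvPolynomial.eval e f) (hd : 2 ≤ d)
    (hsmooth : ∀ a ∈ frontier (hyperbolicityCone f e), a ≠ 0 → ∃ v, (linePoly f a v).coeff 1 ≠ 0) :
    IsSpectrahedralShadow (hyperbolicityCone f e) := by
  classical
  have he0' := he.eval_ne_zero
  -- pointedness
  have hpt : ∀ x ∈ hyperbolicityCone f e, -x ∈ hyperbolicityCone f e → x = 0 :=
    fun x hx hnx => eq_zero_of_mem_of_neg_mem hf he hd hsmooth hx hnx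
  -- `n = 0`
  rcases Nat.eq_zero_or_pos n with hn0 | hn
  · subst hn0
    have : hyperbolicityCone f e = Set.univ := Set.eq_univ_of_forall fun x => by
      rw [Subsingleton.elim x 0]; exact zero_mem_hyperbolicityCone hf he0'
    rw [this]
    exact isSpectrahedralShadowOfSize_univ_zero.isSpectrahedralShadow
  -- the trace functional
  obtain ⟨c, hc⟩ : ∃ c : (Fin n → ℝ) →ₗ[ℝ] ℝ, c = gradForm f e := ⟨_, rfl⟩
  have hcpos : ∀ x ∈ hyperbolicityCone f e, x ≠ 0 → 0 < c x := fun x hx hx0 => by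
    rw [hc]; exact gradForm_dir_pos hf he hpos hpt hx hx0
  have hce : 0 < c e := hcpos e (self_mem_hyperbolicityCone hf he0') (dir_ne_zero hf he (by omega))
  -- the compact base
  obtain ⟨B, hB⟩ : ∃ B : Set (Fin n → ℝ), B = {x ∈ hyperbolicityCone f e | c x = c e} := ⟨_, rfl⟩
  have hBmem : ∀ x, x ∈ B ↔ x ∈ hyperbolicityCone f e ∧ c x = c e := fun x => by rw [hB]; rfl
  have hBc : IsCompact B := by rw [hB, hc]; exact isCompact_base hf he hpos hpt
  have heB : e ∈ B := (hBmem e).2 ⟨self_mem_hyperbolicityCone hf he0', rfl⟩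
  -- coordinates on `ker c`
  have hker : Module.finrank ℝ (LinearMap.ker c) = n - 1 := by
    have h1 := c.finrank_range_add_finrank_ker
    have h2 : Module.finrank ℝ (LinearMap.range c) = 1 := by
      have : LinearMap.range c = ⊤ := LinearMap.range_eq_top.2 fun r =>
        ⟨(r / c e) • e, by rw [map_smul, smul_eq_mul, div_mul_cancel₀ _ hce.ne']⟩
      rw [this, finrank_top, Module.finrank_self]
    rw [h2, Module.finrank_fin_fun] at h1
    omega
  obtain ⟨bK⟩ : Nonempty (Module.Basis (Fin (n - 1)) ℝ (LinearMap.ker c)) :=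
    ⟨Module.finBasisOfFinrankEq ℝ _ hker⟩
  obtain ⟨φ₀, hφ₀⟩ : ∃ φ₀ : (Fin (n - 1) → ℝ) →ₗ[ℝ] (Fin n → ℝ),
      φ₀ = (LinearMap.ker c).subtype ∘ₗ bK.equivFun.symm.toLinearMap := ⟨_, rfl⟩
  have hφ₀ker : ∀ y, c (φ₀ y) = 0 := fun y => by
    rw [hφ₀]; exact LinearMap.mem_ker.1 (Submodule.coe_mem _)
  have hφ₀inj : LinearMap.ker φ₀ = ⊥ := by
    rw [hφ₀]
    exact LinearMap.ker_eq_bot.2 ((LinearMap.ker c).injective_subtype.comp bK.equivFun.symm.injective)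
  have hφ₀surj : ∀ w, c w = 0 → ∃ y, φ₀ y = w := fun w hw =>
    ⟨bK.equivFun ⟨w, LinearMap.mem_ker.2 hw⟩, by rw [hφ₀]; simp⟩
  obtain ⟨M, hM⟩ : ∃ M : Matrix (Fin n) (Fin (n - 1)) ℝ, ∀ y, φ₀ y = M *ᵥ y :=
    ⟨LinearMap.toMatrix' φ₀, fun y => (LinearMap.toMatrix'_mulVec φ₀ y).symm⟩
  -- the pulled-back polynomial and the set `S'`
  obtain ⟨g, hg⟩ : ∃ g : MvPolynomial (Fin (n - 1)) ℝ, g = affinePullback f e M := ⟨_, rfl⟩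
  have hgeval : ∀ y, MvPolynomial.eval y g = MvPolynomial.eval (e + φ₀ y) f := fun y => by
    rw [hg, eval_affinePullback, hM]
  have hglin : ∀ y v, linePoly g y v = linePoly f (e + φ₀ y) (φ₀ v) := fun y v => by
    rw [hg, linePoly_affinePullback, hM, hM]
  obtain ⟨S', hS'⟩ : ∃ S' : Set (Fin (n - 1) → ℝ), S' = {y | e + φ₀ y ∈ hyperbolicityCone f e} :=
    ⟨_, rfl⟩
  have hS'mem : ∀ y, y ∈ S' ↔ e + φ₀ y ∈ hyperbolicityCone f e := fun y => by rw [hS']; rfl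
  have hφcont : Continuous fun y : Fin (n - 1) → ℝ => e + φ₀ y :=
    continuous_const.add φ₀.continuous_of_finiteDimensional
  have hS'closed : IsClosed S' := by
    rw [hS']; exact (isClosed_hyperbolicityCone hf he).preimage hφcont
  have hS'B : ∀ y, y ∈ S' ↔ e + φ₀ y ∈ B := fun y => by
    rw [hS'mem, hBmem, map_add, hφ₀ker, add_zero]; simp
  have hS'compact : IsCompact S' := by
    have h1 : S' = φ₀ ⁻¹' ((Homeomorph.addLeft e) ⁻¹' B) := by
      ext y; rw [hS'B]; simp
    rw [h1]
    exact (LinearMap.isClosedEmbedding_of_injective hφ₀inj).isCompact_preimage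
      ((Homeomorph.addLeft e).isCompact_preimage.2 hBc)
  have hS'bdd : Bornology.IsBounded S' := hS'compact.isBounded
  have hS'convex : Convex ℝ S' := by
    rw [hS']
    exact ((convex_hyperbolicityCone hf he).translate_preimage_right e).linear_preimage φ₀
  -- the interior
  have hUopen : IsOpen {y : Fin (n - 1) → ℝ | e + φ₀ y ∈ openHyperbolicityCone f e} :=
    (he.isOpen_openHyperbolicityCone hf).preimage hφcont
  have hUint : {y : Fin (n - 1) → ℝ | e + φ₀ y ∈ openHyperbolicityCone f e} ⊆ interior S' :=
    interior_maximal (fun y hy => (hS'mem y).2 (openHyperbolicityCone_subset f e hy)) hUopen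
  have h0int : (0 : Fin (n - 1) → ℝ) ∈ interior S' :=
    hUint (by simpa using self_mem_openHyperbolicityCone hf he0')
  -- boundary points of `S'` are smooth boundary points of `Λ`
  have hbdry : ∀ y ∈ S', MvPolynomial.eval (e + φ₀ y) f = 0 →
      e + φ₀ y ≠ 0 ∧ 0 < (linePoly f (e + φ₀ y) e).coeff 1 := by
    intro y hy hzero
    have hmem := (hS'mem y).1 hy
    have hne0 : e + φ₀ y ≠ 0 := fun h0 => by
      have := congrArg c h0
      rw [map_add, hφ₀ker, add_zero, map_zero] at this
      exact hce.ne' this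
    have hfr' : e + φ₀ y ∈ frontier (hyperbolicityCone f e) := by
      rw [frontier_hyperbolicityCone hf he]; exact ⟨hmem, hzero⟩
    exact ⟨hne0, coeff_one_linePoly_dir_pos hf he hpos hmem hzero (hsmooth _ hfr' hne0)⟩
  have hfr : ∀ a' ∈ frontier S', MvPolynomial.eval (e + φ₀ a') f = 0 := by
    intro a' ha'
    by_contra hne
    exact ha'.2 (hUint (mem_openHyperbolicityCone_of_eval_ne_zero
      ((hS'mem a').1 (hS'closed.frontier_subset ha')) hne))
  -- strict quasi-concavity of `g` on `S'`
  have hsqc : ∀ y ∈ S', IsStrictlyQuasiConcaveAt g y := by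
    intro y hy v hv h1
    rw [hglin] at h1 ⊢
    have hV : φ₀ v ≠ 0 := fun h0 => hv (LinearMap.ker_eq_bot.1 hφ₀inj (by rw [h0, map_zero]))
    have hw : e + φ₀ y ∈ hyperbolicityCone f e := (hS'mem y).1 hy
    by_cases hw0 : MvPolynomial.eval (e + φ₀ y) f = 0
    · obtain ⟨hne0, hb1⟩ := hbdry y hy hw0
      refine coeff_two_linePoly_neg_of_boundary hf he hpos hw hw0 hb1 h1 fun hline => ?_
      -- if `f` vanished on the line, the whole line would lie in the bounded set `S'`
      have hpt_eq : ∀ u : ℝ, e + φ₀ (y + u • v) = e + φ₀ y + u • φ₀ v := fun u => by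
        rw [map_add, map_smul, add_assoc]
      have hzero : ∀ u : ℝ, MvPolynomial.eval (e + φ₀ (y + u • v)) f = 0 := fun u => by
        rw [hpt_eq, ← eval_linePoly, hline, Polynomial.eval_zero]
      refine false_of_line_subset hS'bdd hS'closed hy hv fun u₀ hu₀ => ?_
      have hb : e + φ₀ (y + u₀ • v) ∈ hyperbolicityCone f e := (hS'mem _).1 hu₀
      obtain ⟨-, hb1'⟩ := hbdry _ hu₀ (hzero u₀)
      have hev := eventually_mem_hyperbolicityCone_iff hf he hpos hb (hzero u₀) hb1'.ne'
      have hpath : Continuous fun u : ℝ => e + φ₀ (y + u • v) :=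
        hφcont.comp (continuous_const.add (continuous_id.smul continuous_const))
      filter_upwards [hpath.continuousAt.eventually hev] with u hu
      exact (hS'mem _).2 (hu.2 (by rw [hzero]))
    · exact coeff_two_linePoly_neg_of_interior hf he hpos hpt
        (mem_openHyperbolicityCone_of_eval_ne_zero hw hw0) hV h1
  -- the local H–N sets around boundary points are spectrahedral shadows
  have hN : ∀ a' ∈ frontier S', ∃ ε : ℝ, 0 < ε ∧
      IsSpectrahedralShadow (S' ∩ {y | ∑ i, (y i - a' i) ^ 2 ≤ ε ^ 2}) := by
    intro a' ha'
    have ha'S : a' ∈ S' := hS'closed.frontier_subset ha'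
    have hmem := (hS'mem a').1 ha'S
    have hzero := hfr a' ha'
    obtain ⟨-, hb1⟩ := hbdry a' ha'S hzero
    have hev := eventually_mem_hyperbolicityCone_iff hf he hpos hmem hzero hb1.ne'
    obtain ⟨δ, hδ, hball⟩ := Metric.eventually_nhds_iff.1 (hφcont.continuousAt.eventually hev)
    have hiff : ∀ y, ∑ i, (y i - a' i) ^ 2 ≤ (δ / 2) ^ 2 → (y ∈ S' ↔ 0 ≤ MvPolynomial.eval y g) := by
      intro y hy
      have hdist : dist y a' < δ := by
        rw [dist_eq_norm]
        refine norm_lt_of_sumSq_lt hδ (lt_of_le_of_lt ?_ (by nlinarith : (δ / 2) ^ 2 < δ ^ 2))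
        simpa only [Pi.sub_apply] using hy
      rw [hS'mem, hgeval]; exact hball hdist
    -- `∇g(a') ≠ 0` inside the hyperplane: Euler's relation `⟨∇f(a), a⟩ = d f(a) = 0` versus
    -- `⟨∇f(a), e⟩ > 0`
    have hgrad : gradForm g a' ≠ 0 := by
      intro h0
      have h1 : gradForm g a' a' = 0 := by rw [h0, LinearMap.zero_apply]
      rw [gradForm_apply, hglin] at h1
      have hE := linePoly_self_eq_zero hf hzero
      have h2 : (linePoly f (e + φ₀ a') (e + φ₀ a')).coeff 1 =
          (linePoly f (e + φ₀ a') e).coeff 1 + (linePoly f (e + φ₀ a') (φ₀ a')).coeff 1 := by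
        rw [← gradForm_apply, ← gradForm_apply, ← gradForm_apply, map_add]
      rw [hE, Polynomial.coeff_zero, h1, add_zero] at h2
      exact hb1.ne' h2.symm
    exact exists_isSpectrahedralShadow_inter_ball hS'convex (by rw [hgeval]; exact hzero) hgrad
      (hsqc a' ha'S) (half_pos hδ) hiff
  -- `S'` is a spectrahedral shadow
  have hS'shadow : IsSpectrahedralShadow S' := by
    rcases Nat.eq_zero_or_pos (n - 1) with hk0 | hkpos
    · have : S' = Set.univ := Set.eq_univ_of_forall fun y => by
        have hy : y = 0 := funext fun i => absurd i.2 (by omega)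
        rw [hy]; exact interior_subset h0int
      rw [this]
      exact isSpectrahedralShadowOfSize_univ_zero.isSpectrahedralShadow
    · exact isSpectrahedralShadow_of_frontier_cover hkpos hS'compact hS'convex hN
  -- back to `ℝⁿ`: the base `B = e + φ₀(S')` and the cone over it
  have hBeq : B = (fun y => φ₀ y + e) '' S' := by
    ext x
    constructor
    · intro hx
      obtain ⟨-, hxc⟩ := (hBmem x).1 hx
      obtain ⟨y, hy⟩ := hφ₀surj (x - e) (by rw [map_sub, hxc, sub_self])
      refine ⟨y, (hS'B y).2 (by rw [hy, add_sub_cancel]; exact hx), ?_⟩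
      change φ₀ y + e = x
      rw [hy, sub_add_cancel]
    · rintro ⟨y, hy, rfl⟩
      change φ₀ y + e ∈ B
      rw [add_comm]; exact (hS'B y).1 hy
  have hBshadow : IsSpectrahedralShadow B := by rw [hBeq]; exact hS'shadow.affine_image φ₀ e
  have hcone := hBshadow.coneOver hBc.isBounded ⟨e, heB⟩ ((c e)⁻¹ • c) fun s hs => by
    rw [LinearMap.smul_apply, ((hBmem s).1 hs).2, smul_eq_mul, inv_mul_cancel₀ hce.ne']
  have hΛeq : hyperbolicityCone f e = {x | ∃ t : ℝ, 0 ≤ t ∧ ∃ s ∈ B, x = t • s} := by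
    ext x
    constructor
    · intro hx
      rcases eq_or_ne x 0 with rfl | hx0
      · exact ⟨0, le_rfl, e, heB, by rw [zero_smul]⟩
      · have ht : 0 < c x / c e := div_pos (hcpos x hx hx0) hce
        refine ⟨c x / c e, ht.le, (c x / c e)⁻¹ • x, (hBmem _).2 ⟨smul_mem_hyperbolicityCone hf hx
          (inv_pos.2 ht), ?_⟩, by rw [smul_smul, mul_inv_cancel₀ ht.ne', one_smul]⟩
        rw [map_smul, smul_eq_mul, inv_div, div_mul_eq_mul_div, mul_div_assoc,
          div_self (hcpos x hx hx0).ne', mul_one]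
    · rintro ⟨t, ht, s, hs, rfl⟩
      rcases ht.eq_or_lt with h0 | htpos
      · rw [← h0, zero_smul]; exact zero_mem_hyperbolicityCone hf he0'
      · exact smul_mem_hyperbolicityCone hf ((hBmem s).1 hs).1 htpos
  rw [hΛeq]
  exact hcone

/-- **Netzer–Sanyal 2015, Theorem 1.1: smooth hyperbolicity cones are spectrahedral shadows** —
the discharge of the named fact `NetzerSanyal2014_thm11`. The proof is Netzer–Sanyal's
(Gårding convexity, compact base, local structure and Lemma 2.4 at smooth boundary points, finite
cover of the boundary, Krein–Milman, convex hull of finitely many shadows, conical hull), with the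
Helton–Nie input replaced by the exactness of the Putinar-type moment relaxation on sufficiently
small balls (`exists_isSpectrahedralShadow_inter_ball`), which needs no Positivstellensatz.
[cite: NetzerSanyal2014, Theorem 1.1] [cite: HeltonNie2008, Theorem 2 and §2.2] -/
theorem NetzerSanyal2014_thm11_holds : NetzerSanyal2014_thm11 := by
  intro n h e d hf he hsm
  classical
  have hsmooth : ∀ a ∈ frontier (hyperbolicityCone h e), a ≠ 0 → ∃ v, (linePoly h a v).coeff 1 ≠ 0 := by
    intro a ha ha0
    obtain ⟨j, hj⟩ := hsm a ha ha0
    exact ⟨Pi.single j 1, by rwa [coeff_one_linePoly_single]⟩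
  -- reduce to `f(e) > 0`
  suffices key : ∀ f : MvPolynomial (Fin n) ℝ, f.IsHomogeneous d → IsHyperbolic f e →
      0 < MvPolynomial.eval e f →
      (∀ a ∈ frontier (hyperbolicityCone f e), a ≠ 0 → ∃ v, (linePoly f a v).coeff 1 ≠ 0) →
      IsSpectrahedralShadow (hyperbolicityCone f e) by
    rcases lt_or_gt_of_ne he.eval_ne_zero with hneg | hpos
    · have := key (-h) hf.neg (isHyperbolic_neg_iff.2 he) (by rw [map_neg]; linarith) (by
        rw [hyperbolicityCone_neg]
        intro a ha ha0
        obtain ⟨v, hv⟩ := hsmooth a ha ha0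
        exact ⟨v, by rwa [linePoly_neg, Polynomial.coeff_neg, neg_ne_zero]⟩)
      rwa [hyperbolicityCone_neg] at this
    · exact key h hf he hpos hsmooth
  intro f hf he hpos hsmooth
  rcases Nat.lt_or_ge d 2 with hd | hd
  · interval_cases d
    · exact isSpectrahedralShadow_hyperbolicityCone_of_degree_zero hf he
    · exact isSpectrahedralShadow_hyperbolicityCone_of_degree_one hf hpos
  · exact isSpectrahedralShadow_hyperbolicityCone_of_two_le' hf he hpos hd hsmooth


end Main


end Literature.AlgebraicGeometry.HyperbolicPolynomials
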